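import Literature.ComputerArithmetic.HallmanIpsen2023.ProbabilisticBounds
import HarnessLib

/-!
# Probabilistic error bounds for compensated (Kahan) summation
(Hallman–Ipsen 2023, §4.3 "Probabilistic bounds": Lemma 22, Theorem 23, Lemma 24, Theorem 25 of
the arXiv text, with the appendix §7 "Proof of Lemma 24")

HONEST FRAMING (ENGINES group, unit `eng-quad-4`, kernels lane of the `certquad` engine — shared
numerical engines serving client cells; rigour lives in the verifiers; every published number
belongs to a client cell's ledger, not to the engines group): MODEL-form mathematics from the
literature, typed and PROVED; nothing here is new and nothing enters as a named fact. It completes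
the compensated-summation analysis begun in `ComputationalTree.lean` (Part "Compensated": the
finite-precision model (e_model1) and the exact child-error recurrences of Theorem 19): under
mean-independent roundoffs the error `e_n = ŝ_n − s_n` of Kahan's compensated summation of
`x_1, …, x_n` satisfies, with probability at least `1 − (δ + η)`,
`|e_n| ≤ u √(2 ln(2/δ)) (|s_n| + γ(√2 + αu)(Σ_{k=2}^n x_k²)^{1/2} + γαu(Σ_{k=2}^n s_k²)^{1/2})`
with `α = √6 + O(u)`, `γ = 1 + O(u²)` explicit — to first order `u √(2 ln(2/δ)) (|s_n| + √2 ‖x‖₂)`,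
i.e. essentially ONE rounding of the exact sum.

## Sources

* E. Hallman, I. C. F. Ipsen, *Precision-aware deterministic and probabilistic error bounds for
  floating point summation*, Numer. Math. 155 (2023) 83–119, doi 10.1007/s00211-023-01370-y,
  arXiv:2203.15928 — bib key `HallmanIpsen2023`; read at the arXiv text, whose running numbers are
  used: §4 eq. (e_model1) (the model recurrences, `η_k, σ_k, δ_k, β_k` the roundoffs of
  `y_k, s_k, z_k, c_k`, with `η_2 = 0`), §4.1 Theorem 19 (thm:comp_recurrences, eqs. (eqn:cbase),
  (eqn:yrec), (eqn:srec), (eqn:zrec), (eqn:crec)), §4.3 Lemma 22 (lemma:sddot: with probability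
  ≥ `1 − η` simultaneously `|ÿ_k| ≤ Y_k`, `|s̈_k| ≤ S_k`, `|z̈_k| ≤ Z_k`, `|c̈_k| ≤ C_k`,
  `2 ≤ k ≤ n`, with the bounds (eqn:bbase) `Y_2 = S_2 = 0`, `Z_2 = u|s_2|`,
  `C_2 = u(|x_2| + Z_2) + u|s_2|` and
  (eqn:bsrec) `Y_k = C_{k−1}(1+u)`,
  `S_k = λ_{n,η} u (Σ_{j=3}^k ((|x_j|+Y_j)² + C_{j−1}² + (|x_{j−1}|+Z_{j−1})²))^{1/2}`,
  `Z_k = u(|s_k|+S_k) + u(|x_k|+Y_k) + Y_k`, `C_k = u(|x_k|+Z_k) + u(|s_k|+S_k)`,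
  `λ_{n,η} = √(2 ln(2n/η))`), Theorem 23 (lemma:compProbErr:
  `|e_n| ≤ u √(2 ln(2/δ)) ((s_n+S_n)² + Σ_{j=3}^n (…))^{1/2}` with probability ≥ `1 − (δ+η)`),
  Lemma 24 (lemma:alphaBound: `(Σ_{j=3}^k (Y_j² + C_{j−1}² + Z_{j−1}²))^{1/2}
  ≤ α u (Σ_{j=2}^{k−1} (|s_j|+|x_j|+S_j)²)^{1/2}`), Theorem 25 (thm:comp_prob_err, first line, with
  `α = √(1+3(1+u)²+2(1+u)⁴)/(1 − u(1+u)²)`,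
  `γ = √(1+λ²u²) (1 + λ α √(2n) u² exp(λ² α² n u⁴))`), and the appendix §7 (apx:alpha:
  `β = u(1+u)²`, `ω_k = |s_k|+|x_k|+S_k`, `Z_k = u ω_k + (1+u)² C_{k−1}`,
  `C_k = u(1+u) ω_k + β C_{k−1}`,
  `‖c‖₂ ≤ u(1+u)/(1−β) ‖w‖₂`, `‖z‖₂ ≤ u(2+2u+u²)/(1−β) ‖w‖₂`, the Frobenius-norm step).
* `MartingaleBounds.lean` (this directory): the roundoff model (model:second) =
  `ConnollyHighamMary2021.SRErrorModel μ u ρ`, predictable martingale transforms, HI Lemma 2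
  (`azumaHoeffding_trunc`) and Lemma 3 (relaxed Azuma–Hoeffding); `ComputationalTree.lean`:
  `Compensated.state/hatS/hatC/hatY/hatZ/psum`, the errors `dS, dY, dZ, dC`, the child-errors
  `ddY, ddS, ddZ, ddC` and Theorem 19 (`base`, `ddY_rec`, `ddZ_rec`, `ddC_rec`, `ddS_step`);
  `ProbabilisticBounds.lean`: `STree.lam m η = √(2 ln(2m/η))` and the `φ`-type bound
  `STree.binomialSum_le_one_add` (`Σ_{m=0}^h c^m √(h choose m) ≤ 1 + c √(2h) exp(c² h)`, the chain
  (eqn:CSineq) of the proof of Theorem 15, which the proof of Theorem 25 invokes: "Proceed as in the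
  proof of Theorem 15").

## How the algorithm meets the probability space

Compensated summation of `x_1, …, x_n` commits four roundoffs per step `k ≥ 2`, in program order
`y_k, s_k, z_k, c_k`: `η_k, σ_k, δ_k, β_k` (with `η_2 = 0`: `ŷ_2 = x_2 − ĉ_1 = x_2` is exact). HI's
Lemma 22 / Theorems 23, 25 take "`σ_2, δ_2, β_2, η_3, σ_3, δ_3, …, η_n, σ_n` mean-independent
zero-mean random variables" under (model:second). We read them off ONE model sequence
`ρ_0, ρ_1, …` (`SRErrorModel μ u ρ`: measurable, `|ρ_i| ≤ u` surely,
`∫ g(ρ_0, …, ρ_{i−1}) ρ_i dμ = 0` for bounded measurable `g`) at the linear index `4k + op`,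
`op = 0, 1, 2, 3` for `η_k, σ_k, δ_k, β_k`
(`etaOf`, `sigmaOf`, `deltaOf`, `betaOf`; `etaOf v 2 = 0`) — a linear order consistent with the
program order, which is what makes `s̈_k` (eqn:srec) and `e_n = ṡ_n` (eqn:comp_sdot) martingale
transforms `Σ_{i<N} a_i ρ_i` with PREDICTABLE coefficients (`ÿ_j` depends on the roundoffs of index
`< 4j`, `z̈_j` on those `< 4j+2`, `c̈_j` on those `< 4j+3`). Unused indices are harmless: HI's own
sequence, padded with zeros at the unused indices, is such a model sequence, so nothing is lost.

## Contents

* realisation: `etaOf/sigmaOf/deltaOf/betaOf`, `rstate` (the realised `(ŝ_k, ĉ_k)`), the realised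
  child-errors `ydd, sdd, zdd, cdd` and error `err` (`= e_n = ṡ_n`), their dependence on the past
  (`rstate_congr`, …) and measurability;
* the bounds of Lemma 22: `bstate` / `bY bS bZ bC` (`Y_k, S_k, Z_k, C_k`) and the radicand `bR`
  (`S_k = c √(bR k)`, `c = λ_{n,η} u`), with the printed recurrences (`bY_succ`, `bR_eq_sum`,
  `bZ_succ`, `bC_succ`, `b_two`);
* the martingale form of (eqn:srec): `coefC`/`bndC` with `sdd_eq_transform`, `sum_sq_bndC`,
  predictability `isPredictable_coefC`, and the deterministic core of Lemma 22 `bounds_of_sdd`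
  (`|s̈_j| ≤ S_j` for `j ≤ m` forces the `Y, Z, C` bounds for `j ≤ m`);
* the failure events `FailS` ("some `|s̈_k| > S_k`") and `Fail` (some bound of
  (eqn:comp_errorBounds) fails), `failS_of_fail`; the Azuma step `measure_sddFail_le`, the union
  bound `measure_failS_le`, LEMMA 22 `measure_failS_le_eta` / `measure_fail_le_eta`;
* the martingale form of `e_n` (`coefE`/`bndE`, `err_eq_transform`, `sum_sq_bndE`) and THEOREM 23
  `errBound_childBounds_of_failS` (any `c ≥ 0`) / `errBound_childBounds` (`c = λ_{n,η} u`);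
* LEMMA 24 `frobenius_le_alpha` (`alpha`, `omg` = `ω_k`; `sum_sq_bC_le`, `sqrt_sum_sq_bZ_le` = the
  appendix bounds on `‖c_k‖₂`, `‖z_k‖₂`); the closed-form chain `sqrt_bR_le_step` (first display of
  the proof of Theorem 25), `binB`/`binB_step` and `sqrt_bR_le_binB` (eqn:c_Rbound), `gamma`,
  `closedForm_le` ((eqn:c_binBound) = `STree.binomialSum_le_one_add`, and the last display) and
  THEOREM 25 `errBound_closedForm`.

## Typing notes (read before citing)

* Probabilities as in `MartingaleBounds.lean`/`ProbabilisticBounds.lean`: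
  `μ {ω | bound < |e ω|} ≤ ENNReal.ofReal (p + η)`; HI's probability parameter `δ` is called `p`
  (the letter `δ` is a roundoff), and their assumptions `0 < η < 1`, `0 < δ < 1 − η` (non-vacuity)
  are weakened to `0 < η`, `0 < p`.
* Theorem 23 prints the radicand `(s_n + S_n)²`; we type `(|s_n| + S_n)²`, which is what its proof
  (the increment bound `|(s_n + s̈_n) σ_n| ≤ u(|s_n| + S_n)`) yields and what the first display of
  the proof of Theorem 25 (`u √(2 ln(2/δ)) |s_n| + …`) uses; for `s_n ≥ 0` the two coincide.
* `α` requires `u(1+u)² < 1` (its denominator `1 − β > 0`, `β = u(1+u)²`; HI tacitly assume `u`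
  small); Lemma 24 and Theorem 25 carry this hypothesis. `λ_{n,η} u = c` enters the bounds only as
  the parameter `c ≥ 0` of `bstate`; the deterministic Lemma 24 and the chain hold for every
  `c ≥ 0`.
* Theorem 25's binomial factor is `Σ_{j=0}^{n} (λαu²)^j √(n choose j)`; the chain actually yields
  it with `n − 3` (the number of previous steps) in place of `n`, which we weaken to `n` as printed.
  The SECOND printed line of Theorem 25 (`≤ u √(2 ln(2/δ)) (1 + √2 + √6(√n+1) u) Σ|x_k| + O(u³)`)
  and Corollary 20 / Remark 21 (first-order expressions with `O(u²)` terms) are asymptotic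
  bookkeeping and are not typed.
* Inputs are `x 1, x 2, …` (`x 0` unused); for `n ≤ 1` there is no roundoff and `e_n = 0`, for
  `n = 2` only `σ_2` contributes (`S_2 = 0`); all statements hold as typed for every `n`.
-/

open MeasureTheory ProbabilityTheory Finset Real
open scoped NNReal ENNReal

namespace Literature.ComputerArithmetic.HallmanIpsen2023

open Literature.ComputerArithmetic.ConnollyHighamMary2021 (SRErrorModel)

namespace Compensated

/-! ### Realisation of the four roundoff streams on one model sequence -/

/-- `η_k` = the roundoff of `y_k = x_k − c_{k−1}`, read at index `4k`; `η_2 = 0` (`ŷ_2 = x_2` is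
exact since `ĉ_1 = 0`). [cite: HallmanIpsen2023, §4, eq. (e_model1) ("where `η_2 = 0`")] -/
def etaOf (v : ℕ → ℝ) (k : ℕ) : ℝ := if k = 2 then 0 else v (4 * k)

/-- `σ_k` = the roundoff of `s_k = s_{k−1} + y_k`, read at index `4k+1`.
[cite: HallmanIpsen2023, §4, eq. (e_model1)] -/
def sigmaOf (v : ℕ → ℝ) (k : ℕ) : ℝ := v (4 * k + 1)

/-- `δ_k` = the roundoff of `z_k = s_k − s_{k−1}`, read at index `4k+2`.
[cite: HallmanIpsen2023, §4, eq. (e_model1)] -/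
def deltaOf (v : ℕ → ℝ) (k : ℕ) : ℝ := v (4 * k + 2)

/-- `β_k` = the roundoff of `c_k = z_k − y_k`, read at index `4k+3`.
[cite: HallmanIpsen2023, §4, eq. (e_model1)] -/
def betaOf (v : ℕ → ℝ) (k : ℕ) : ℝ := v (4 * k + 3)

/-- The realised finite-precision state `(ŝ_k, ĉ_k)` of compensated summation when the roundoffs
are read off the sequence `v`. [cite: HallmanIpsen2023, §4, eq. (e_model1)] -/
noncomputable def rstate (x v : ℕ → ℝ) (k : ℕ) : ℝ × ℝ :=
  state x (etaOf v) (sigmaOf v) (deltaOf v) (betaOf v) k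

/-- Realised child-error `ÿ_k`. [cite: HallmanIpsen2023, §4.1, eq. (def:compChiErr)] -/
noncomputable def ydd (x v : ℕ → ℝ) (k : ℕ) : ℝ :=
  ddY x (etaOf v) (sigmaOf v) (deltaOf v) (betaOf v) k
/-- Realised child-error `s̈_k`. [cite: HallmanIpsen2023, §4.1, eq. (def:compChiErr)] -/
noncomputable def sdd (x v : ℕ → ℝ) (k : ℕ) : ℝ :=
  ddS x (etaOf v) (sigmaOf v) (deltaOf v) (betaOf v) k
/-- Realised child-error `z̈_k`. [cite: HallmanIpsen2023, §4.1, eq. (def:compChiErr)] -/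
noncomputable def zdd (x v : ℕ → ℝ) (k : ℕ) : ℝ :=
  ddZ x (etaOf v) (sigmaOf v) (deltaOf v) (betaOf v) k
/-- Realised child-error `c̈_k`. [cite: HallmanIpsen2023, §4.1, eq. (def:compChiErr)] -/
noncomputable def cdd (x v : ℕ → ℝ) (k : ℕ) : ℝ :=
  ddC x (etaOf v) (sigmaOf v) (deltaOf v) (betaOf v) k
/-- The realised summation error `e_n = ṡ_n = ŝ_n − s_n`.
[cite: HallmanIpsen2023, §4.1, eq. (def:compFwdErr) and §4.3, Theorem 23 ("`e_n = ṡ_n`")] -/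
noncomputable def err (x v : ℕ → ℝ) (n : ℕ) : ℝ :=
  dS x (etaOf v) (sigmaOf v) (deltaOf v) (betaOf v) n

section Realised

variable (x : ℕ → ℝ)

/-- `η_2 = 0`. [cite: HallmanIpsen2023, §4, eq. (e_model1)] -/
@[simp] theorem etaOf_two (v : ℕ → ℝ) : etaOf v 2 = 0 := by simp [etaOf]

/-- `η_k = v(4k)` for `k ≠ 2`. [cite: HallmanIpsen2023, §4, eq. (e_model1)] -/
theorem etaOf_of_ne_two (v : ℕ → ℝ) {k : ℕ} (hk : k ≠ 2) : etaOf v k = v (4 * k) := by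
  simp [etaOf, hk]

/-- `(ŝ_0, ĉ_0) = (0, 0)` (unused index). [cite: HallmanIpsen2023, §4, eq. (e_model1)] -/
@[simp] theorem rstate_zero (v : ℕ → ℝ) : rstate x v 0 = (0, 0) := rfl

/-- `(ŝ_1, ĉ_1) = (x_1, 0)`. [cite: HallmanIpsen2023, §4, eq. (e_model1)] -/
@[simp] theorem rstate_one (v : ℕ → ℝ) : rstate x v 1 = (x 1, 0) := rfl

/-- The realised model recurrence for `ŝ_k`: `ŝ_k = (ŝ_{k−1} + (x_k − ĉ_{k−1})(1+η_k))(1+σ_k)`.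
[cite: HallmanIpsen2023, §4, eq. (e_model1)] -/
theorem rstate_fst_succ (v : ℕ → ℝ) (k : ℕ) :
    (rstate x v (k + 2)).1
      = ((rstate x v (k + 1)).1 + (x (k + 2) - (rstate x v (k + 1)).2) * (1 + etaOf v (k + 2)))
          * (1 + v (4 * (k + 2) + 1)) := by
  show hatS x (etaOf v) (sigmaOf v) (deltaOf v) (betaOf v) (k + 2) = _
  rw [hatS_succ, hatY_succ]
  rfl

/-- The realised model recurrence for `ĉ_k`:
`ĉ_k = ((ŝ_k − ŝ_{k−1})(1+δ_k) − (x_k − ĉ_{k−1})(1+η_k))(1+β_k)`.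
[cite: HallmanIpsen2023, §4, eq. (e_model1)] -/
theorem rstate_snd_succ (v : ℕ → ℝ) (k : ℕ) :
    (rstate x v (k + 2)).2
      = (((rstate x v (k + 2)).1 - (rstate x v (k + 1)).1) * (1 + v (4 * (k + 2) + 2))
          - (x (k + 2) - (rstate x v (k + 1)).2) * (1 + etaOf v (k + 2)))
        * (1 + v (4 * (k + 2) + 3)) := by
  show hatC x (etaOf v) (sigmaOf v) (deltaOf v) (betaOf v) (k + 2) = _
  rw [hatC_succ, hatZ_succ, hatY_succ]
  rfl

/-- `ÿ_{k+1} = −ĉ_k`. [cite: HallmanIpsen2023, §4.1, eq. (def:compChiErr) (`ÿ_k = −ċ_{k−1}`)] -/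
theorem ydd_succ (v : ℕ → ℝ) (k : ℕ) : ydd x v (k + 1) = - (rstate x v k).2 := rfl

/-- `ÿ_0 = 0`, and `e_0 = 0`-type conventions: `ydd x v 0 = 0`. [cite: HallmanIpsen2023, §4.1,
eq. (def:compChiErr)] -/
@[simp] theorem ydd_zero (v : ℕ → ℝ) : ydd x v 0 = 0 := rfl

/-- `s̈_{k+1} = ṡ_k + ẏ_{k+1} = (ŝ_k − s_k) + ((x_{k+1} − ĉ_k)(1+η_{k+1}) − x_{k+1})`.
[cite: HallmanIpsen2023, §4.1, eq. (def:compChiErr)] -/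
theorem sdd_succ (v : ℕ → ℝ) (k : ℕ) :
    sdd x v (k + 1) = ((rstate x v k).1 - psum x k)
      + ((x (k + 1) - (rstate x v k).2) * (1 + etaOf v (k + 1)) - x (k + 1)) := rfl

/-- `s̈_0 = 0`. [cite: HallmanIpsen2023, §4.1, eq. (def:compChiErr)] -/
@[simp] theorem sdd_zero (v : ℕ → ℝ) : sdd x v 0 = 0 := rfl

/-- `z̈_{k+1} = ṡ_{k+1} − ṡ_k`. [cite: HallmanIpsen2023, §4.1, eq. (def:compChiErr)] -/
theorem zdd_succ (v : ℕ → ℝ) (k : ℕ) :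
    zdd x v (k + 1) = ((rstate x v (k + 1)).1 - psum x (k + 1)) - ((rstate x v k).1 - psum x k) :=
  rfl

/-- `z̈_0 = 0`. [cite: HallmanIpsen2023, §4.1, eq. (def:compChiErr)] -/
@[simp] theorem zdd_zero (v : ℕ → ℝ) : zdd x v 0 = 0 := rfl

/-- `c̈_{k+1} = ż_{k+1} − ẏ_{k+1} = (ŝ_{k+1} − ŝ_k)(1+δ_{k+1}) − (x_{k+1} − ĉ_k)(1+η_{k+1})`.
[cite: HallmanIpsen2023, §4.1, eq. (def:compChiErr)] -/
theorem cdd_succ (v : ℕ → ℝ) (k : ℕ) :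
    cdd x v (k + 1) = (((rstate x v (k + 1)).1 - (rstate x v k).1) * (1 + v (4 * (k + 1) + 2))
        - x (k + 1)) - ((x (k + 1) - (rstate x v k).2) * (1 + etaOf v (k + 1)) - x (k + 1)) := rfl

/-- `c̈_0 = 0`. [cite: HallmanIpsen2023, §4.1, eq. (def:compChiErr)] -/
@[simp] theorem cdd_zero (v : ℕ → ℝ) : cdd x v 0 = 0 := by
  simp [cdd, ddC, dZ, dY, hatZ, hatY]

/-- `e_n = ŝ_n − s_n`. [cite: HallmanIpsen2023, §4.1, eq. (def:compFwdErr)] -/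
theorem err_eq (v : ℕ → ℝ) (n : ℕ) : err x v n = (rstate x v n).1 - psum x n := rfl

/-! ### Dependence on the past and measurability -/

/-- The realised state is a function of the EARLIER roundoffs: `ŝ_k` depends only on the
roundoffs of index `< 4k+2` and `ĉ_k` on those of index `< 4k+4` (program order `y, s, z, c`).
[cite: HallmanIpsen2023, §4.3, proof of Lemma 22 ("`s̈_k` can be written as a martingale with
respect to `σ_2, δ_2, β_2, η_3, …, η_k`")] -/
theorem rstate_congr (k : ℕ) :
    (∀ v w : ℕ → ℝ, (∀ j < 4 * k + 2, v j = w j) → (rstate x v k).1 = (rstate x w k).1)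
    ∧ (∀ v w : ℕ → ℝ, (∀ j < 4 * k + 4, v j = w j) → rstate x v k = rstate x w k) := by
  induction k with
  | zero => exact ⟨fun v w _ => by simp, fun v w _ => by simp⟩
  | succ k ih =>
      cases k with
      | zero => exact ⟨fun v w _ => by simp, fun v w _ => by simp⟩
      | succ k =>
          obtain ⟨-, ih2⟩ := ih
          have hη : ∀ v w : ℕ → ℝ, (∀ j < 4 * (k + 2) + 2, v j = w j) →
              etaOf v (k + 2) = etaOf w (k + 2) := by
            intro v w h
            by_cases hk : k + 2 = 2
            · simp [etaOf, hk]
            · rw [etaOf_of_ne_two v hk, etaOf_of_ne_two w hk]; exact h _ (by omega)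
          have hfst : ∀ v w : ℕ → ℝ, (∀ j < 4 * (k + 2) + 2, v j = w j) →
              (rstate x v (k + 2)).1 = (rstate x w (k + 2)).1 := by
            intro v w h
            rw [rstate_fst_succ, rstate_fst_succ, ih2 v w (fun j hj => h j (by omega)), hη v w h,
              h (4 * (k + 2) + 1) (by omega)]
          refine ⟨hfst, fun v w h => ?_⟩
          have h1 : (rstate x v (k + 2)).1 = (rstate x w (k + 2)).1 :=
            hfst v w (fun j hj => h j (by omega))
          have h2 : (rstate x v (k + 2)).2 = (rstate x w (k + 2)).2 := by
            rw [rstate_snd_succ, rstate_snd_succ, h1, ih2 v w (fun j hj => h j (by omega)),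
              hη v w (fun j hj => h j (by omega)), h (4 * (k + 2) + 2) (by omega),
              h (4 * (k + 2) + 3) (by omega)]
          exact Prod.ext h1 h2

/-- `η_k` is a measurable function of the roundoff sequence. [folklore] -/
private theorem measurable_etaOf (k : ℕ) : Measurable (fun v : ℕ → ℝ => etaOf v k) := by
  unfold etaOf
  by_cases hk : k = 2
  · simp only [hk, if_true]; exact measurable_const
  · simp only [hk, if_false]; exact measurable_pi_apply _

/-- The realised state is a measurable function of the roundoff sequence (a random variable).
[cite: HallmanIpsen2023, §1.2, eq. (model:second) (roundoffs as random variables)] -/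
theorem measurable_rstate (k : ℕ) : Measurable (fun v : ℕ → ℝ => rstate x v k) := by
  induction k with
  | zero => simp only [rstate_zero]; exact measurable_const
  | succ k ih =>
      cases k with
      | zero => simp only [zero_add, rstate_one]; exact measurable_const
      | succ k =>
          have h1 : Measurable (fun v : ℕ → ℝ => (rstate x v (k + 2)).1) := by
            simp only [rstate_fst_succ]
            exact ((ih.fst.add ((measurable_const.sub ih.snd).mul
              (measurable_const.add (measurable_etaOf (k + 2))))).mul
              (measurable_const.add (measurable_pi_apply _)))
          have h2 : Measurable (fun v : ℕ → ℝ => (rstate x v (k + 2)).2) := by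
            simp only [rstate_snd_succ]
            exact (((h1.sub ih.fst).mul (measurable_const.add (measurable_pi_apply _))).sub
              ((measurable_const.sub ih.snd).mul
                (measurable_const.add (measurable_etaOf (k + 2))))).mul
              (measurable_const.add (measurable_pi_apply _))
          exact h1.prodMk h2

/-- `s̈_k` depends only on the roundoffs of index `< 4k+1` … more precisely `< 4(k−1)+4 + 1`;
we record: agreement below `4k` suffices for `ÿ_k`, below `4k+1` for `s̈_k`, below `4k+2` for
`z̈_k`, below `4k+3` for `c̈_k`. [cite: HallmanIpsen2023, §4.3, proof of Lemma 22] -/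
theorem ydd_congr {v w : ℕ → ℝ} (k : ℕ) (h : ∀ j < 4 * k, v j = w j) : ydd x v k = ydd x w k := by
  cases k with
  | zero => rfl
  | succ k => rw [ydd_succ, ydd_succ, (rstate_congr x k).2 v w (fun j hj => h j (by omega))]

/-- See `ydd_congr`. [cite: HallmanIpsen2023, §4.3, proof of Lemma 22] -/
theorem sdd_congr {v w : ℕ → ℝ} (k : ℕ) (h : ∀ j < 4 * k + 1, v j = w j) :
    sdd x v k = sdd x w k := by
  cases k with
  | zero => rfl
  | succ k =>
      have hη : etaOf v (k + 1) = etaOf w (k + 1) := by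
        by_cases hk : k + 1 = 2
        · simp [etaOf, hk]
        · rw [etaOf_of_ne_two v hk, etaOf_of_ne_two w hk]; exact h _ (by omega)
      rw [sdd_succ, sdd_succ, (rstate_congr x k).2 v w (fun j hj => h j (by omega)), hη]

/-- See `ydd_congr`. [cite: HallmanIpsen2023, §4.3, proof of Lemma 22] -/
theorem zdd_congr {v w : ℕ → ℝ} (k : ℕ) (h : ∀ j < 4 * k + 2, v j = w j) :
    zdd x v k = zdd x w k := by
  cases k with
  | zero => rfl
  | succ k =>
      rw [zdd_succ, zdd_succ, (rstate_congr x (k + 1)).1 v w h,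
        (rstate_congr x k).1 v w (fun j hj => h j (by omega))]

/-- See `ydd_congr`. [cite: HallmanIpsen2023, §4.3, proof of Lemma 22] -/
theorem cdd_congr {v w : ℕ → ℝ} (k : ℕ) (h : ∀ j < 4 * k + 3, v j = w j) :
    cdd x v k = cdd x w k := by
  cases k with
  | zero => simp
  | succ k =>
      have hη : etaOf v (k + 1) = etaOf w (k + 1) := by
        by_cases hk : k + 1 = 2
        · simp [etaOf, hk]
        · rw [etaOf_of_ne_two v hk, etaOf_of_ne_two w hk]; exact h _ (by omega)
      rw [cdd_succ, cdd_succ, (rstate_congr x (k + 1)).1 v w (fun j hj => h j (by omega)),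
        (rstate_congr x k).2 v w (fun j hj => h j (by omega)), hη, h (4 * (k + 1) + 2) (by omega)]

/-- The error `e_n` depends only on the roundoffs of index `< 4n+2`.
[cite: HallmanIpsen2023, §4.3, proof of Theorem 23] -/
theorem err_congr {v w : ℕ → ℝ} (n : ℕ) (h : ∀ j < 4 * n + 2, v j = w j) :
    err x v n = err x w n := by
  rw [err_eq, err_eq, (rstate_congr x n).1 v w h]

/-- Measurability of the realised child-errors.
[cite: HallmanIpsen2023, §1.2, eq. (model:second)] -/
theorem measurable_ydd (k : ℕ) : Measurable (fun v : ℕ → ℝ => ydd x v k) := by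
  cases k with
  | zero => simp only [ydd_zero]; exact measurable_const
  | succ k => simp only [ydd_succ]; exact (measurable_rstate x k).snd.neg

/-- Measurability of `s̈_k`. [cite: HallmanIpsen2023, §1.2, eq. (model:second)] -/
theorem measurable_sdd (k : ℕ) : Measurable (fun v : ℕ → ℝ => sdd x v k) := by
  cases k with
  | zero => simp only [sdd_zero]; exact measurable_const
  | succ k =>
      simp only [sdd_succ]
      exact ((measurable_rstate x k).fst.sub measurable_const).add
        (((measurable_const.sub (measurable_rstate x k).snd).mul
          (measurable_const.add (measurable_etaOf (k + 1)))).sub measurable_const)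

/-- Measurability of `z̈_k`. [cite: HallmanIpsen2023, §1.2, eq. (model:second)] -/
theorem measurable_zdd (k : ℕ) : Measurable (fun v : ℕ → ℝ => zdd x v k) := by
  cases k with
  | zero => simp only [zdd_zero]; exact measurable_const
  | succ k =>
      simp only [zdd_succ]
      exact ((measurable_rstate x (k + 1)).fst.sub measurable_const).sub
        ((measurable_rstate x k).fst.sub measurable_const)

/-- Measurability of `c̈_k`. [cite: HallmanIpsen2023, §1.2, eq. (model:second)] -/
theorem measurable_cdd (k : ℕ) : Measurable (fun v : ℕ → ℝ => cdd x v k) := by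
  cases k with
  | zero => simp only [cdd_zero]; exact measurable_const
  | succ k =>
      simp only [cdd_succ]
      exact ((((measurable_rstate x (k + 1)).fst.sub (measurable_rstate x k).fst).mul
        (measurable_const.add (measurable_pi_apply _))).sub measurable_const).sub
        (((measurable_const.sub (measurable_rstate x k).snd).mul
          (measurable_const.add (measurable_etaOf (k + 1)))).sub measurable_const)

/-- Measurability of `e_n`. [cite: HallmanIpsen2023, §1.2, eq. (model:second)] -/
theorem measurable_err (n : ℕ) : Measurable (fun v : ℕ → ℝ => err x v n) := by
  simp only [err_eq]; exact (measurable_rstate x n).fst.sub measurable_const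

end Realised

/-! ### Theorem 19 for the realised quantities -/

section Recurrences

variable (x v : ℕ → ℝ)

/-- (eqn:cbase): `ÿ_2 = 0`, `s̈_2 = 0`, `z̈_2 = s_2 σ_2`, `c̈_2 = (x_2 + z̈_2) δ_2 + s_2 σ_2`.
[cite: HallmanIpsen2023, §4.1, Theorem 19, eq. (eqn:cbase)] -/
theorem r_base :
    ydd x v 2 = 0 ∧ sdd x v 2 = 0 ∧ zdd x v 2 = psum x 2 * sigmaOf v 2 ∧
      cdd x v 2 = (x 2 + zdd x v 2) * deltaOf v 2 + psum x 2 * sigmaOf v 2 :=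
  base x (etaOf v) (sigmaOf v) (deltaOf v) (betaOf v) (etaOf_two v)

/-- `s̈_2 = 0`. [cite: HallmanIpsen2023, §4.1, Theorem 19, eq. (eqn:cbase)] -/
@[simp] theorem sdd_two : sdd x v 2 = 0 := (r_base x v).2.1

/-- `ÿ_2 = 0`. [cite: HallmanIpsen2023, §4.1, Theorem 19, eq. (eqn:cbase)] -/
@[simp] theorem ydd_two : ydd x v 2 = 0 := (r_base x v).1

/-- (eqn:yrec) `ÿ_k = −c̈_{k−1}(1+β_{k−1})`, `k ≥ 3`. [cite: HallmanIpsen2023, §4.1, Theorem 19,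
eq. (eqn:yrec)] -/
theorem ydd_rec (k : ℕ) : ydd x v (k + 3) = - cdd x v (k + 2) * (1 + betaOf v (k + 2)) :=
  ddY_rec x (etaOf v) (sigmaOf v) (deltaOf v) (betaOf v) k

/-- (eqn:zrec) `z̈_k = (s_k + s̈_k) σ_k + (x_k + ÿ_k) η_k + ÿ_k`, `k ≥ 2`.
[cite: HallmanIpsen2023, §4.1, Theorem 19, eq. (eqn:zrec)] -/
theorem zdd_rec (k : ℕ) :
    zdd x v (k + 2) = (psum x (k + 2) + sdd x v (k + 2)) * sigmaOf v (k + 2)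
      + (x (k + 2) + ydd x v (k + 2)) * etaOf v (k + 2) + ydd x v (k + 2) :=
  ddZ_rec x (etaOf v) (sigmaOf v) (deltaOf v) (betaOf v) k

/-- (eqn:crec) `c̈_k = (x_k + z̈_k) δ_k + (s_k + s̈_k) σ_k`, `k ≥ 2`.
[cite: HallmanIpsen2023, §4.1, Theorem 19, eq. (eqn:crec)] -/
theorem cdd_rec (k : ℕ) :
    cdd x v (k + 2) = (x (k + 2) + zdd x v (k + 2)) * deltaOf v (k + 2)
      + (psum x (k + 2) + sdd x v (k + 2)) * sigmaOf v (k + 2) :=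
  ddC_rec x (etaOf v) (sigmaOf v) (deltaOf v) (betaOf v) k

/-- (eqn:srec), one step:
`s̈_k = s̈_{k−1} + (x_k + ÿ_k) η_k − c̈_{k−1} β_{k−1} − (x_{k−1} + z̈_{k−1}) δ_{k−1}`, `k ≥ 3`.
[cite: HallmanIpsen2023, §4.1, Theorem 19, eq. (eqn:srec)] -/
theorem sdd_step (k : ℕ) :
    sdd x v (k + 3) = sdd x v (k + 2) + (x (k + 3) + ydd x v (k + 3)) * etaOf v (k + 3)
      - cdd x v (k + 2) * betaOf v (k + 2) - (x (k + 2) + zdd x v (k + 2)) * deltaOf v (k + 2) :=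
  ddS_step x (etaOf v) (sigmaOf v) (deltaOf v) (betaOf v) k

/-- `e_n = ṡ_n = (s_n + s̈_n) σ_n + s̈_n` (eqn:comp_sdot), `n ≥ 2`.
[cite: HallmanIpsen2023, §4.1, Lemma "first-order recurrences", eq. (eqn:comp_sdot); §4.3, proof
of Theorem 23 ("substitute (eqn:srec) into (eqn:comp_sdot)")] -/
theorem err_rec (k : ℕ) :
    err x v (k + 2) = (psum x (k + 2) + sdd x v (k + 2)) * sigmaOf v (k + 2) + sdd x v (k + 2) :=
  dS_eq x (etaOf v) (sigmaOf v) (deltaOf v) (betaOf v) k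

/-- `e_0 = 0` (no inputs). [cite: HallmanIpsen2023, §4.1, eq. (def:compFwdErr)] -/
@[simp] theorem err_zero : err x v 0 = 0 := by simp [err_eq, psum]

/-- `e_1 = ŝ_1 − s_1 = 0`. [cite: HallmanIpsen2023, §4, eq. (e_model1) (`s_1 = x_1`)] -/
@[simp] theorem err_one : err x v 1 = 0 := by simp [err_eq, psum]

end Recurrences

/-! ### The bounds `Y_k, S_k, Z_k, C_k` of Lemma 22 -/

/-- One step `k−1 → k` (`k ≥ 3`) of the bound recursion (eqn:bsrec), acting on the running triple
`(R_{k−1}, Z_{k−1}, C_{k−1})` where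
`R_k = Σ_{j=3}^k ((|x_j|+Y_j)² + C_{j−1}² + (|x_{j−1}|+Z_{j−1})²)` is the radicand of
`S_k = c √R_k` (`c = λ_{n,η} u`); arguments `xk = x_k`, `xp = x_{k−1}`,
`sk = s_k`. [cite: HallmanIpsen2023, §4.3, Lemma 22, eq. (eqn:bsrec)] -/
noncomputable def bstep (u c xk xp sk : ℝ) (q : ℝ × ℝ × ℝ) : ℝ × ℝ × ℝ :=
  ( q.1 + ((|xk| + q.2.2 * (1 + u)) ^ 2 + q.2.2 ^ 2 + (|xp| + q.2.1) ^ 2),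
    u * (|sk| + c * Real.sqrt (q.1 + ((|xk| + q.2.2 * (1 + u)) ^ 2 + q.2.2 ^ 2
        + (|xp| + q.2.1) ^ 2)))
      + u * (|xk| + q.2.2 * (1 + u)) + q.2.2 * (1 + u),
    u * (|xk| + (u * (|sk| + c * Real.sqrt (q.1 + ((|xk| + q.2.2 * (1 + u)) ^ 2 + q.2.2 ^ 2
        + (|xp| + q.2.1) ^ 2))) + u * (|xk| + q.2.2 * (1 + u)) + q.2.2 * (1 + u)))
      + u * (|sk| + c * Real.sqrt (q.1 + ((|xk| + q.2.2 * (1 + u)) ^ 2 + q.2.2 ^ 2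
        + (|xp| + q.2.1) ^ 2))) )

/-- The running triple `(R_k, Z_k, C_k)` of Lemma 22 with parameter `c` (`= λ_{n,η} u`):
(eqn:bbase) `R_2 = 0` (`S_2 = 0`), `Z_2 = u|s_2|`, `C_2 = u(|x_2| + Z_2) + u|s_2|`; (eqn:bsrec) for
`k ≥ 3`; indices `0, 1` unused (zero). [cite: HallmanIpsen2023, §4.3, Lemma 22, eqs. (eqn:bbase),
(eqn:bsrec)] -/
noncomputable def bstate (x : ℕ → ℝ) (u c : ℝ) : ℕ → ℝ × ℝ × ℝ
  | 0 => (0, 0, 0)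
  | 1 => (0, 0, 0)
  | 2 => (0, u * |psum x 2|, u * (|x 2| + u * |psum x 2|) + u * |psum x 2|)
  | k + 3 => bstep u c (x (k + 3)) (x (k + 2)) (psum x (k + 3)) (bstate x u c (k + 2))

/-- The radicand `R_k = Σ_{j=3}^k ((|x_j|+Y_j)² + C_{j−1}² + (|x_{j−1}|+Z_{j−1})²)` of `S_k`.
[cite: HallmanIpsen2023, §4.3, Lemma 22, eq. (eqn:bsrec)] -/
noncomputable def bR (x : ℕ → ℝ) (u c : ℝ) (k : ℕ) : ℝ := (bstate x u c k).1

/-- `Z_k`. [cite: HallmanIpsen2023, §4.3, Lemma 22, eqs. (eqn:bbase), (eqn:bsrec)] -/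
noncomputable def bZ (x : ℕ → ℝ) (u c : ℝ) (k : ℕ) : ℝ := (bstate x u c k).2.1

/-- `C_k`. [cite: HallmanIpsen2023, §4.3, Lemma 22, eqs. (eqn:bbase), (eqn:bsrec)] -/
noncomputable def bC (x : ℕ → ℝ) (u c : ℝ) (k : ℕ) : ℝ := (bstate x u c k).2.2

/-- `Y_k`: `Y_2 = 0`, `Y_k = C_{k−1}(1+u)` for `k ≥ 3`.
[cite: HallmanIpsen2023, §4.3, Lemma 22, eqs. (eqn:bbase), (eqn:bsrec)] -/
noncomputable def bY (x : ℕ → ℝ) (u c : ℝ) : ℕ → ℝ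
  | k + 3 => bC x u c (k + 2) * (1 + u)
  | _ => 0

/-- `S_k = c √R_k` (`c = λ_{n,η} u`): `S_2 = 0`,
`S_k = λ_{n,η} u (Σ_{j=3}^k ((|x_j|+Y_j)² + C_{j−1}² + (|x_{j−1}|+Z_{j−1})²))^{1/2}`.
[cite: HallmanIpsen2023, §4.3, Lemma 22, eqs. (eqn:bbase), (eqn:bsrec)] -/
noncomputable def bS (x : ℕ → ℝ) (u c : ℝ) (k : ℕ) : ℝ := c * Real.sqrt (bR x u c k)

section Bounds

variable (x : ℕ → ℝ) (u c : ℝ)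

/-- (eqn:bbase): `R_2 = 0`, `Y_2 = 0`, `S_2 = 0`, `Z_2 = u|s_2|`, `C_2 = u(|x_2| + Z_2) + u|s_2|`.
[cite: HallmanIpsen2023, §4.3, Lemma 22, eq. (eqn:bbase)] -/
theorem b_two : bR x u c 2 = 0 ∧ bY x u c 2 = 0 ∧ bS x u c 2 = 0 ∧ bZ x u c 2 = u * |psum x 2| ∧
    bC x u c 2 = u * (|x 2| + bZ x u c 2) + u * |psum x 2| := by
  refine ⟨rfl, rfl, by simp [bS, bR, bstate], rfl, rfl⟩

/-- The unused indices: all bounds vanish at `k = 0, 1`. [cite: HallmanIpsen2023, §4.3, Lemma 22] -/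
theorem b_le_one {k : ℕ} (hk : k ≤ 1) :
    bR x u c k = 0 ∧ bY x u c k = 0 ∧ bS x u c k = 0 ∧ bZ x u c k = 0 ∧ bC x u c k = 0 := by
  interval_cases k <;> simp [bR, bY, bS, bZ, bC, bstate]

/-- (eqn:bsrec) `Y_k = C_{k−1}(1+u)`. [cite: HallmanIpsen2023, §4.3, Lemma 22, eq. (eqn:bsrec)] -/
theorem bY_succ (k : ℕ) : bY x u c (k + 3) = bC x u c (k + 2) * (1 + u) := rfl

/-- (eqn:bsrec), the radicand: `R_k = R_{k−1} + ((|x_k|+Y_k)² + C_{k−1}² + (|x_{k−1}|+Z_{k−1})²)`.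
[cite: HallmanIpsen2023, §4.3, Lemma 22, eq. (eqn:bsrec)] -/
theorem bR_succ (k : ℕ) : bR x u c (k + 3) = bR x u c (k + 2)
    + ((|x (k + 3)| + bY x u c (k + 3)) ^ 2 + bC x u c (k + 2) ^ 2
      + (|x (k + 2)| + bZ x u c (k + 2)) ^ 2) := rfl

/-- (eqn:bsrec) `Z_k = u(|s_k|+S_k) + u(|x_k|+Y_k) + Y_k`.
[cite: HallmanIpsen2023, §4.3, Lemma 22, eq. (eqn:bsrec)] -/
theorem bZ_succ (k : ℕ) : bZ x u c (k + 3) = u * (|psum x (k + 3)| + bS x u c (k + 3))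
    + u * (|x (k + 3)| + bY x u c (k + 3)) + bY x u c (k + 3) := rfl

/-- (eqn:bsrec) `C_k = u(|x_k|+Z_k) + u(|s_k|+S_k)`.
[cite: HallmanIpsen2023, §4.3, Lemma 22, eq. (eqn:bsrec)] -/
theorem bC_succ (k : ℕ) : bC x u c (k + 3) = u * (|x (k + 3)| + bZ x u c (k + 3))
    + u * (|psum x (k + 3)| + bS x u c (k + 3)) := rfl

/-- The radicand as the printed sum:
`R_k = Σ_{j=3}^{k} ((|x_j|+Y_j)² + C_{j−1}² + (|x_{j−1}|+Z_{j−1})²)` (`k ≥ 2`).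
[cite: HallmanIpsen2023, §4.3, Lemma 22, eq. (eqn:bsrec) (definition of `S_k`)] -/
theorem bR_eq_sum (k : ℕ) : bR x u c (k + 2) = ∑ j ∈ Ico 3 (k + 3),
    ((|x j| + bY x u c j) ^ 2 + bC x u c (j - 1) ^ 2 + (|x (j - 1)| + bZ x u c (j - 1)) ^ 2) := by
  induction k with
  | zero => simp [(b_two x u c).1]
  | succ k ih =>
      rw [show k + 1 + 2 = k + 3 from rfl, show k + 1 + 3 = k + 3 + 1 from rfl,
        Finset.sum_Ico_succ_top (by omega : 3 ≤ k + 3), ← ih, bR_succ]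
      simp only [show k + 3 - 1 = k + 2 from rfl]

variable {u c}

/-- All bounds are non-negative (`u, c ≥ 0`). [cite: HallmanIpsen2023, §4.3, Lemma 22] -/
theorem b_nonneg (hu : 0 ≤ u) (hc : 0 ≤ c) (k : ℕ) :
    0 ≤ bR x u c k ∧ 0 ≤ bY x u c k ∧ 0 ≤ bS x u c k ∧ 0 ≤ bZ x u c k ∧ 0 ≤ bC x u c k := by
  induction k with
  | zero => simp [b_le_one x u c (show 0 ≤ 1 by norm_num)]
  | succ k ih =>
      cases k with
      | zero => simp [b_le_one x u c (le_refl 1)]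
      | succ k =>
          cases k with
          | zero =>
              obtain ⟨hR, hY, hS, hZ, hC⟩ := b_two x u c
              simp only [zero_add] at *
              rw [hR, hY, hS, hZ, hC, hZ]
              exact ⟨le_rfl, le_rfl, le_rfl, by positivity, by positivity⟩
          | succ k =>
              obtain ⟨hR, -, hS, hZ, hC⟩ := ih
              have hY : 0 ≤ bY x u c (k + 3) := by rw [bY_succ]; positivity
              have hR' : 0 ≤ bR x u c (k + 3) := by rw [bR_succ]; positivity
              have hS' : 0 ≤ bS x u c (k + 3) := by unfold bS; positivity
              have hZ' : 0 ≤ bZ x u c (k + 3) := by rw [bZ_succ]; positivity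
              have hC' : 0 ≤ bC x u c (k + 3) := by rw [bC_succ]; positivity
              exact ⟨hR', hY, hS', hZ', hC'⟩

end Bounds

/-! ### (eqn:srec) as a martingale transform -/

/-- The coefficient process of `s̈`: at index `4j` (`η_j`, `j ≥ 3`) the coefficient `x_j + ÿ_j`, at
`4j+2` (`δ_j`, `j ≥ 2`) the coefficient `−(x_j + z̈_j)`, at `4j+3` (`β_j`, `j ≥ 2`) the coefficient
`−c̈_j`, zero elsewhere — so that `s̈_k = Σ_{i < 4k+1} coefC_i v_i` is (eqn:srec).
[cite: HallmanIpsen2023, §4.1, Theorem 19, eq. (eqn:srec); §4.3, proof of Lemma 22] -/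
noncomputable def coefC (x v : ℕ → ℝ) (i : ℕ) : ℝ :=
  if i % 4 = 0 ∧ 3 ≤ i / 4 then x (i / 4) + ydd x v (i / 4)
  else if i % 4 = 2 ∧ 2 ≤ i / 4 then -(x (i / 4) + zdd x v (i / 4))
  else if i % 4 = 3 ∧ 2 ≤ i / 4 then - cdd x v (i / 4)
  else 0

/-- The CANDIDATE increment bounds of the `s̈`-martingale: `|x_j| + Y_j`, `|x_j| + Z_j`, `C_j` at
the indices of `η_j, δ_j, β_j` (the three displayed bounds in the proof of Lemma 22).
[cite: HallmanIpsen2023, §4.3, proof of Lemma 22 (induction step, the display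
`|(x_j+ÿ_j)η_j| ≤ u(|x_j|+Y_j)`, `|c̈_{j−1}β_{j−1}| ≤ u C_{j−1}`,
`|(x_{j−1}+z̈_{j−1})δ_{j−1}| ≤ u(|x_{j−1}|+Z_{j−1})`)] -/
noncomputable def bndC (x : ℕ → ℝ) (u c : ℝ) (i : ℕ) : ℝ :=
  if i % 4 = 0 ∧ 3 ≤ i / 4 then |x (i / 4)| + bY x u c (i / 4)
  else if i % 4 = 2 ∧ 2 ≤ i / 4 then |x (i / 4)| + bZ x u c (i / 4)
  else if i % 4 = 3 ∧ 2 ≤ i / 4 then bC x u c (i / 4)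
  else 0

section Transform

variable (x : ℕ → ℝ) (u c : ℝ) (v : ℕ → ℝ)

/-- [folklore] index arithmetic for `coefC`/`bndC`. -/
private theorem coefC_eta {k : ℕ} (hk : 3 ≤ k) : coefC x v (4 * k) = x k + ydd x v k := by
  have h1 : 4 * k % 4 = 0 := by omega
  have h2 : 4 * k / 4 = k := by omega
  simp [coefC, h1, h2, hk]

/-- [folklore] -/
private theorem coefC_sigma (k : ℕ) : coefC x v (4 * k + 1) = 0 := by
  have h1 : (4 * k + 1) % 4 = 1 := by omega
  simp [coefC, h1]

/-- [folklore] -/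
private theorem coefC_delta {k : ℕ} (hk : 2 ≤ k) : coefC x v (4 * k + 2) = -(x k + zdd x v k) := by
  have h1 : (4 * k + 2) % 4 = 2 := by omega
  have h2 : (4 * k + 2) / 4 = k := by omega
  simp [coefC, h1, h2, hk]

/-- [folklore] -/
private theorem coefC_beta {k : ℕ} (hk : 2 ≤ k) : coefC x v (4 * k + 3) = - cdd x v k := by
  have h1 : (4 * k + 3) % 4 = 3 := by omega
  have h2 : (4 * k + 3) / 4 = k := by omega
  simp [coefC, h1, h2, hk]

/-- [folklore] -/
private theorem coefC_lt_nine {i : ℕ} (hi : i < 9) : coefC x v i = 0 := by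
  unfold coefC
  rw [if_neg (by omega), if_neg (by omega), if_neg (by omega)]

/-- [folklore] -/
private theorem bndC_eta {k : ℕ} (hk : 3 ≤ k) : bndC x u c (4 * k) = |x k| + bY x u c k := by
  have h1 : 4 * k % 4 = 0 := by omega
  have h2 : 4 * k / 4 = k := by omega
  simp [bndC, h1, h2, hk]

/-- [folklore] -/
private theorem bndC_sigma (k : ℕ) : bndC x u c (4 * k + 1) = 0 := by
  have h1 : (4 * k + 1) % 4 = 1 := by omega
  simp [bndC, h1]

/-- [folklore] -/
private theorem bndC_delta {k : ℕ} (hk : 2 ≤ k) : bndC x u c (4 * k + 2) = |x k| + bZ x u c k := by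
  have h1 : (4 * k + 2) % 4 = 2 := by omega
  have h2 : (4 * k + 2) / 4 = k := by omega
  simp [bndC, h1, h2, hk]

/-- [folklore] -/
private theorem bndC_beta {k : ℕ} (hk : 2 ≤ k) : bndC x u c (4 * k + 3) = bC x u c k := by
  have h1 : (4 * k + 3) % 4 = 3 := by omega
  have h2 : (4 * k + 3) / 4 = k := by omega
  simp [bndC, h1, h2, hk]

/-- [folklore] -/
private theorem bndC_lt_nine {i : ℕ} (hi : i < 9) : bndC x u c i = 0 := by
  unfold bndC
  rw [if_neg (by omega), if_neg (by omega), if_neg (by omega)]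

/-- **(eqn:srec) in martingale-transform form**: `s̈_n = Σ_{i < 4n+1} coefC_i v_i` (`n ≥ 2`) —
"the expression (eqn:srec) for `s̈_k` can be written as a martingale with respect to
`σ_2, δ_2, β_2, η_3, σ_3, δ_3, …, η_k`". [cite: HallmanIpsen2023, §4.3, proof of Lemma 22] -/
theorem sdd_eq_transform {n : ℕ} (hn : 2 ≤ n) :
    sdd x v n = ∑ i ∈ range (4 * n + 1), coefC x v i * v i := by
  obtain ⟨k, rfl⟩ : ∃ k, n = k + 2 := ⟨n - 2, by omega⟩
  clear hn
  induction k with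
  | zero =>
      rw [zero_add, sdd_two]
      exact (sum_eq_zero (fun i hi => by rw [coefC_lt_nine x v (by simpa using hi), zero_mul])).symm
  | succ k ih =>
      have e4 : 4 * (k + 2) + 1 + 1 + 1 + 1 = 4 * (k + 3) := by ring
      have e3 : 4 * (k + 2) + 1 + 1 + 1 = 4 * (k + 2) + 3 := by ring
      have e2 : 4 * (k + 2) + 1 + 1 = 4 * (k + 2) + 2 := by ring
      rw [show k + 1 + 2 = k + 3 from rfl,
        show 4 * (k + 3) + 1 = 4 * (k + 2) + 1 + 1 + 1 + 1 + 1 by ring,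
        sum_range_succ, sum_range_succ, sum_range_succ, sum_range_succ, ← ih, e4, e3, e2,
        coefC_sigma, coefC_delta x v (by omega : 2 ≤ k + 2), coefC_beta x v (by omega : 2 ≤ k + 2),
        coefC_eta x v (by omega : 3 ≤ k + 3), sdd_step,
        etaOf_of_ne_two v (by omega : k + 3 ≠ 2)]
      simp only [betaOf, deltaOf]
      ring

/-- The variance proxy: `Σ_{i < 4n+1} bndC_i² = R_n` (`n ≥ 2`), so that the Azuma–Hoeffding radius
of the `s̈_n`-martingale at failure probability `η/n` is `S_n`.
[cite: HallmanIpsen2023, §4.3, Lemma 22, eq. (eqn:bsrec) and its proof ("Lemma 2 then implies that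
`|s̈_k| ≤ S_k` holds with probability at least `1 − η/n`")] -/
theorem sum_sq_bndC {n : ℕ} (hn : 2 ≤ n) :
    ∑ i ∈ range (4 * n + 1), bndC x u c i ^ 2 = bR x u c n := by
  obtain ⟨k, rfl⟩ : ∃ k, n = k + 2 := ⟨n - 2, by omega⟩
  clear hn
  induction k with
  | zero =>
      rw [zero_add, (b_two x u c).1]
      exact sum_eq_zero (fun i hi => by rw [bndC_lt_nine x u c (by simpa using hi)]; ring)
  | succ k ih =>
      have e4 : 4 * (k + 2) + 1 + 1 + 1 + 1 = 4 * (k + 3) := by ring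
      have e3 : 4 * (k + 2) + 1 + 1 + 1 = 4 * (k + 2) + 3 := by ring
      have e2 : 4 * (k + 2) + 1 + 1 = 4 * (k + 2) + 2 := by ring
      rw [show k + 1 + 2 = k + 3 from rfl,
        show 4 * (k + 3) + 1 = 4 * (k + 2) + 1 + 1 + 1 + 1 + 1 by ring,
        sum_range_succ, sum_range_succ, sum_range_succ, sum_range_succ, ih, e4, e3, e2,
        bndC_sigma, bndC_delta x u c (by omega : 2 ≤ k + 2), bndC_beta x u c (by omega : 2 ≤ k + 2),
        bndC_eta x u c (by omega : 3 ≤ k + 3), bR_succ]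
      ring

/-- The coefficient `coefC_i` depends only on the roundoffs of index `< i` (predictability).
[cite: HallmanIpsen2023, §4.3, proof of Lemma 22 ("martingale with respect to `σ_2, δ_2, β_2, η_3,
…, η_k`")] -/
theorem coefC_congr {v w : ℕ → ℝ} (i : ℕ) (h : ∀ j < i, v j = w j) :
    coefC x v i = coefC x w i := by
  unfold coefC
  have hi : 4 * (i / 4) ≤ i := Nat.mul_div_le i 4
  by_cases h0 : i % 4 = 0 ∧ 3 ≤ i / 4
  · rw [if_pos h0, if_pos h0, ydd_congr x (i / 4) (fun j hj => h j (by omega))]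
  · rw [if_neg h0, if_neg h0]
    by_cases h2 : i % 4 = 2 ∧ 2 ≤ i / 4
    · rw [if_pos h2, if_pos h2, zdd_congr x (i / 4) (fun j hj => h j (by omega))]
    · rw [if_neg h2, if_neg h2]
      by_cases h3 : i % 4 = 3 ∧ 2 ≤ i / 4
      · rw [if_pos h3, if_pos h3, cdd_congr x (i / 4) (fun j hj => h j (by omega))]
      · rw [if_neg h3, if_neg h3]

/-- `coefC_i` is a measurable function of the roundoff sequence.
[cite: HallmanIpsen2023, §1.2, eq. (model:second)] -/
theorem measurable_coefC (i : ℕ) : Measurable (fun v : ℕ → ℝ => coefC x v i) := by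
  unfold coefC
  by_cases h0 : i % 4 = 0 ∧ 3 ≤ i / 4
  · simp only [if_pos h0]; exact measurable_const.add (measurable_ydd x _)
  · simp only [if_neg h0]
    by_cases h2 : i % 4 = 2 ∧ 2 ≤ i / 4
    · simp only [if_pos h2]; exact (measurable_const.add (measurable_zdd x _)).neg
    · simp only [if_neg h2]
      by_cases h3 : i % 4 = 3 ∧ 2 ≤ i / 4
      · simp only [if_pos h3]; exact (measurable_cdd x _).neg
      · simp only [if_neg h3]; exact measurable_const

variable {u c}

/-- The candidate bounds are non-negative. [cite: HallmanIpsen2023, §4.3, Lemma 22] -/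
theorem bndC_nonneg (hu : 0 ≤ u) (hc : 0 ≤ c) (i : ℕ) : 0 ≤ bndC x u c i := by
  unfold bndC
  obtain ⟨-, hY, -, hZ, hC⟩ := b_nonneg x hu hc (i / 4)
  split_ifs
  · positivity
  · positivity
  · exact hC
  · exact le_rfl

end Transform

/-! ### The deterministic core of Lemma 22 -/

section Core

variable (x : ℕ → ℝ) {u c : ℝ} {v : ℕ → ℝ}

/-- [folklore] `|a r| ≤ u A` from `|a| ≤ A`, `|r| ≤ u`. -/
private theorem abs_mul_le_of {a r A u : ℝ} (ha : |a| ≤ A) (hr : |r| ≤ u) : |a * r| ≤ u * A := by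
  rw [abs_mul, mul_comm u]
  exact mul_le_mul ha hr (abs_nonneg _) ((abs_nonneg _).trans ha)

/-- `|η_k| ≤ u`. [cite: HallmanIpsen2023, §4, eq. (e_model1) (roundoffs bounded by `u`)] -/
theorem abs_etaOf_le (hu : 0 ≤ u) (hv : ∀ i, |v i| ≤ u) (k : ℕ) : |etaOf v k| ≤ u := by
  unfold etaOf; split_ifs
  · simpa using hu
  · exact hv _

/-- The step `|c̈_{k−1}| ≤ C_{k−1} ⟹ |ÿ_k| ≤ C_{k−1}(1+u) = Y_k` ("always holds").
[cite: HallmanIpsen2023, §4.3, proof of Lemma 22 (induction step, first display)] -/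
theorem abs_ydd_le (hv : ∀ i, |v i| ≤ u) (k : ℕ) (hC : |cdd x v (k + 2)| ≤ bC x u c (k + 2)) :
    |ydd x v (k + 3)| ≤ bY x u c (k + 3) := by
  rw [ydd_rec, bY_succ, neg_mul, abs_neg, abs_mul]
  have h1 : |1 + betaOf v (k + 2)| ≤ 1 + u := by
    refine (abs_add_le _ _).trans ?_
    rw [abs_one]
    exact add_le_add le_rfl (hv _)
  exact mul_le_mul hC h1 (abs_nonneg _) ((abs_nonneg _).trans hC)

/-- **The deterministic core of LEMMA 22.** If `|s̈_j| ≤ S_j` for `3 ≤ j ≤ m`, then (surely)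
`|ÿ_j| ≤ Y_j`, `|z̈_j| ≤ Z_j`, `|c̈_j| ≤ C_j` for all `2 ≤ j ≤ m`: the basis (eqn:bbase) holds
deterministically and the bounds for `ÿ_k`, `z̈_k`, `c̈_k` "always hold, due to (eqn:yrec),
(eqn:zrec) and (eqn:crec)" given the earlier ones.
[cite: HallmanIpsen2023, §4.3, Lemma 22, proof (induction basis and the deterministic parts of the
induction step)] -/
theorem bounds_of_sdd (hu : 0 ≤ u) (hv : ∀ i, |v i| ≤ u) {m : ℕ}
    (hS : ∀ j, 3 ≤ j → j ≤ m → |sdd x v j| ≤ bS x u c j) :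
    ∀ j, 2 ≤ j → j ≤ m →
      |ydd x v j| ≤ bY x u c j ∧ |zdd x v j| ≤ bZ x u c j ∧ |cdd x v j| ≤ bC x u c j := by
  -- induction over `t` with `j = t + 2`
  suffices H : ∀ t, t + 2 ≤ m →
      |ydd x v (t + 2)| ≤ bY x u c (t + 2) ∧ |zdd x v (t + 2)| ≤ bZ x u c (t + 2)
        ∧ |cdd x v (t + 2)| ≤ bC x u c (t + 2) by
    intro j hj hjm
    obtain ⟨t, rfl⟩ : ∃ t, j = t + 2 := ⟨j - 2, by omega⟩
    exact H t hjm
  intro t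
  induction t with
  | zero =>
      intro _
      obtain ⟨hy, -, hz, hcc⟩ := r_base x v
      obtain ⟨-, hY, -, hZ, hC⟩ := b_two x u c
      simp only [zero_add]
      have hz' : |zdd x v 2| ≤ bZ x u c 2 := by
        rw [hz, hZ]; exact abs_mul_le_of le_rfl (hv _)
      refine ⟨by rw [hy, hY, abs_zero], hz', ?_⟩
      rw [hcc, hC]
      refine (abs_add_le _ _).trans (add_le_add ?_ (abs_mul_le_of le_rfl (hv _)))
      exact abs_mul_le_of ((abs_add_le _ _).trans (add_le_add le_rfl hz')) (hv _)
  | succ t ih =>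
      intro htm
      obtain ⟨-, -, hCp⟩ := ih (by omega)
      have hY : |ydd x v (t + 3)| ≤ bY x u c (t + 3) := abs_ydd_le x hv t hCp
      have hSS : |sdd x v (t + 3)| ≤ bS x u c (t + 3) := hS (t + 3) (by omega) htm
      have hsS : |psum x (t + 3) + sdd x v (t + 3)| ≤ |psum x (t + 3)| + bS x u c (t + 3) :=
        (abs_add_le _ _).trans (add_le_add le_rfl hSS)
      have hxY : |x (t + 3) + ydd x v (t + 3)| ≤ |x (t + 3)| + bY x u c (t + 3) :=
        (abs_add_le _ _).trans (add_le_add le_rfl hY)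
      have hZ : |zdd x v (t + 3)| ≤ bZ x u c (t + 3) := by
        rw [zdd_rec, bZ_succ]
        refine (abs_add_le _ _).trans (add_le_add ((abs_add_le _ _).trans (add_le_add ?_ ?_)) hY)
        · exact abs_mul_le_of hsS (hv _)
        · exact abs_mul_le_of hxY (abs_etaOf_le hu hv _)
      have hxZ : |x (t + 3) + zdd x v (t + 3)| ≤ |x (t + 3)| + bZ x u c (t + 3) :=
        (abs_add_le _ _).trans (add_le_add le_rfl hZ)
      have hC : |cdd x v (t + 3)| ≤ bC x u c (t + 3) := by
        rw [cdd_rec, bC_succ]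
        exact (abs_add_le _ _).trans (add_le_add (abs_mul_le_of hxZ (hv _))
          (abs_mul_le_of hsS (hv _)))
      exact ⟨hY, hZ, hC⟩

/-- Off the event "some `|s̈_j| > S_j`, `3 ≤ j ≤ m`" every increment bound of the `s̈`-martingales
up to step `m+1` holds: `|coefC_i| ≤ bndC_i` for all `i < 4m+5`.
[cite: HallmanIpsen2023, §4.3, proof of Lemma 22 (induction step: "By the induction hypothesis, the
bounds … all hold simultaneously")] -/
theorem abs_coefC_le_bndC (hu : 0 ≤ u) (hv : ∀ i, |v i| ≤ u) {m : ℕ}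
    (hS : ∀ j, 3 ≤ j → j ≤ m → |sdd x v j| ≤ bS x u c j) :
    ∀ i < 4 * m + 5, |coefC x v i| ≤ bndC x u c i := by
  intro i hi
  have hb := bounds_of_sdd x hu hv hS
  unfold coefC bndC
  by_cases h0 : i % 4 = 0 ∧ 3 ≤ i / 4
  · rw [if_pos h0, if_pos h0]
    obtain ⟨t, ht⟩ : ∃ t, i / 4 = t + 3 := ⟨i / 4 - 3, by omega⟩
    rw [ht]
    refine (abs_add_le _ _).trans (add_le_add le_rfl (abs_ydd_le x hv t ?_))
    exact (hb (t + 2) (by omega) (by omega)).2.2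
  · rw [if_neg h0, if_neg h0]
    by_cases h2 : i % 4 = 2 ∧ 2 ≤ i / 4
    · rw [if_pos h2, if_pos h2, abs_neg]
      exact (abs_add_le _ _).trans (add_le_add le_rfl (hb (i / 4) h2.2 (by omega)).2.1)
    · rw [if_neg h2, if_neg h2]
      by_cases h3 : i % 4 = 3 ∧ 2 ≤ i / 4
      · rw [if_pos h3, if_pos h3, abs_neg]
        exact (hb (i / 4) h3.2 (by omega)).2.2
      · rw [if_neg h3, if_neg h3, abs_zero]

end Core

/-! ### LEMMA 22: all child-errors are bounded simultaneously, with probability `≥ 1 − η` -/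

/-- The failure event that is controlled probabilistically: "some `|s̈_k| > S_k`, `3 ≤ k ≤ n`".
[cite: HallmanIpsen2023, §4.3, Lemma 22, proof ("`|s̈_k| ≤ S_k` holds with probability at least
`1 − η/n`")] -/
def FailS (x : ℕ → ℝ) (u c : ℝ) (v : ℕ → ℝ) (n : ℕ) : Prop :=
  ∃ k, 3 ≤ k ∧ k ≤ n ∧ bS x u c k < |sdd x v k|

/-- The failure event of LEMMA 22: some bound of (eqn:comp_errorBounds) fails,
`|ÿ_k| > Y_k ∨ |s̈_k| > S_k ∨ |z̈_k| > Z_k ∨ |c̈_k| > C_k` for some `2 ≤ k ≤ n`.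
[cite: HallmanIpsen2023, §4.3, Lemma 22, eq. (eqn:comp_errorBounds)] -/
def Fail (x : ℕ → ℝ) (u c : ℝ) (v : ℕ → ℝ) (n : ℕ) : Prop :=
  ∃ k, 2 ≤ k ∧ k ≤ n ∧ (bY x u c k < |ydd x v k| ∨ bS x u c k < |sdd x v k|
    ∨ bZ x u c k < |zdd x v k| ∨ bC x u c k < |cdd x v k|)

section Lemma22

variable (x : ℕ → ℝ) {u c : ℝ} {v : ℕ → ℝ}

/-- Off `FailS` all the `s̈`-bounds hold, including the sure one `|s̈_2| = 0 ≤ 0 = S_2`.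
[cite: HallmanIpsen2023, §4.3, Lemma 22, proof] -/
theorem abs_sdd_le_of_not_failS {n : ℕ} (hF : ¬ FailS x u c v n) :
    ∀ j, 2 ≤ j → j ≤ n → |sdd x v j| ≤ bS x u c j := by
  intro j hj hjn
  rcases (show j = 2 ∨ 3 ≤ j by omega) with rfl | hj3
  · rw [sdd_two, (b_two x u c).2.2.1, abs_zero]
  · exact not_lt.mp (fun hlt => hF ⟨j, hj3, hjn, hlt⟩)

/-- By the deterministic core, the failure event of Lemma 22 IS the event "some `|s̈_k| > S_k`".
[cite: HallmanIpsen2023, §4.3, Lemma 22, proof ("always holds")] -/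
theorem failS_of_fail (hu : 0 ≤ u) (hv : ∀ i, |v i| ≤ u) {n : ℕ}
    (hF : Fail x u c v n) : FailS x u c v n := by
  by_contra hnS
  obtain ⟨k, hk2, hkn, hor⟩ := hF
  have hS := abs_sdd_le_of_not_failS x hnS
  have hb := bounds_of_sdd x hu hv (m := n) (fun j hj hjn => hS j (by omega) hjn) k hk2 hkn
  rcases hor with h | h | h | h
  · exact absurd hb.1 (not_le.mpr h)
  · exact absurd (hS k hk2 hkn) (not_le.mpr h)
  · exact absurd hb.2.1 (not_le.mpr h)
  · exact absurd hb.2.2 (not_le.mpr h)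

variable {Ω : Type*} [MeasurableSpace Ω] {μ : Measure Ω} {ρ : ℕ → Ω → ℝ}

omit [MeasurableSpace Ω] in
/-- The coefficient process of `s̈` is PREDICTABLE with respect to the model sequence.
[cite: HallmanIpsen2023, §4.3, proof of Lemma 22 ("martingale with respect to `σ_2, δ_2, β_2, η_3,
σ_3, δ_3, …, η_k`")] -/
theorem isPredictable_coefC : IsPredictable ρ (fun i ω => coefC x (fun j => ρ j ω) i) := fun i =>
  ⟨fun v => coefC x v i, measurable_coefC x i,
    fun _ _ hvw => coefC_congr x i (fun j hj => hvw j (Set.mem_Iio.mpr hj)), fun _ => rfl⟩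

variable [IsProbabilityMeasure μ]

/-- [folklore] `√(u² x) = u √x` for `u ≥ 0`. -/
private theorem sqrt_sq_mul' {u y : ℝ} (hu : 0 ≤ u) : Real.sqrt (u ^ 2 * y) = u * Real.sqrt y := by
  rw [Real.sqrt_mul (sq_nonneg u), Real.sqrt_sq hu]

/-- **The Azuma step of LEMMA 22.** With `c = √(2 ln(2/p)) u`: the event "`|s̈_k| > S_k` although
`|s̈_j| ≤ S_j` for all `3 ≤ j < k`" has probability at most `p` (`k ≥ 3`) — Lemma 2 for the
martingale (eqn:srec), whose increments obey the three displayed bounds off the earlier failures,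
with `(Σ_i c_i²)^{1/2} √(2 ln(2/p)) = S_k`.
[cite: HallmanIpsen2023, §4.3, Lemma 22, proof (induction step: "Lemma 2 then implies that
`|s̈_k| ≤ S_k` holds with probability at least `1 − η/n`")] -/
theorem measure_sddFail_le (h : SRErrorModel μ u ρ) {p : ℝ} (hp : 0 < p)
    (hc : c = Real.sqrt (2 * Real.log (2 / p)) * u) (k : ℕ) :
    μ {ω | bS x u c (k + 3) < |sdd x (fun j => ρ j ω) (k + 3)|
        ∧ ∀ j, 3 ≤ j → j < k + 3 → |sdd x (fun j => ρ j ω) j| ≤ bS x u c j}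
      ≤ ENNReal.ofReal p := by
  have hu : 0 ≤ u := u_nonneg h
  have hc0 : 0 ≤ c := by rw [hc]; positivity
  set a : ℕ → Ω → ℝ := fun i ω => coefC x (fun j => ρ j ω) i with ha
  set A : ℕ → ℝ := fun i => bndC x u c i with hA
  have hP : IsPredictable ρ a := isPredictable_coefC x
  have hA0 : ∀ i, 0 ≤ A i := fun i => bndC_nonneg x hu hc0 i
  set N : ℕ := 4 * (k + 3) + 1 with hN
  have hvar : ∑ i ∈ range N, (A i * u) ^ 2 = u ^ 2 * bR x u c (k + 3) := by
    rw [← sum_sq_bndC x u c (by omega : 2 ≤ k + 3), mul_sum]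
    exact sum_congr rfl (fun i _ => by ring)
  have hrad : azumaRadius (∑ i ∈ range N, (A i * u) ^ 2) p = bS x u c (k + 3) := by
    rw [hvar, azumaRadius, sqrt_sq_mul' hu, bS, hc]; ring
  refine (measure_mono ?_).trans (azumaHoeffding_trunc h hP hA0 N hp)
  intro ω hω
  obtain ⟨hlt, hgood⟩ := hω
  show azumaRadius (∑ i ∈ range N, (A i * u) ^ 2) p < |truncTransform a A ρ N ω|
  have hbd : ∀ i < N, |a i ω| ≤ A i := fun i hi =>
    abs_coefC_le_bndC x hu (fun i => h.bounded i ω) (m := k + 2)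
      (fun j hj hjm => hgood j hj (by omega)) i (by omega)
  rw [hrad, truncTransform_eq_transform hbd, transform,
    ← sdd_eq_transform x (fun j => ρ j ω) (by omega : 2 ≤ k + 3)]
  exact hlt

/-- **The union bound of LEMMA 22** ("induction over `k` and the failure probability"): with
`c = √(2 ln(2/p)) u`, `μ {some |s̈_k| > S_k, 3 ≤ k ≤ m + 2} ≤ m p`.
[cite: HallmanIpsen2023, §4.3, Lemma 22, proof (induction hypothesis "with probability at least
`1 − (k−1)η/n`")] -/
theorem measure_failS_le (h : SRErrorModel μ u ρ) {p : ℝ} (hp : 0 < p)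
    (hc : c = Real.sqrt (2 * Real.log (2 / p)) * u) :
    ∀ m : ℕ, μ {ω | FailS x u c (fun j => ρ j ω) (m + 2)} ≤ (m : ℝ≥0∞) * ENNReal.ofReal p
  | 0 => by
      have hempty : {ω | FailS x u c (fun j => ρ j ω) (0 + 2)} = ∅ := by
        ext ω
        simp only [Set.mem_setOf_eq, Set.mem_empty_iff_false, iff_false, FailS, not_exists,
          not_and]
        intro k hk hk2; omega
      rw [hempty, measure_empty]; exact bot_le
  | m + 1 => by
      have ih := measure_failS_le h hp hc m
      have hsub : {ω | FailS x u c (fun j => ρ j ω) (m + 1 + 2)}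
          ⊆ {ω | FailS x u c (fun j => ρ j ω) (m + 2)}
            ∪ {ω | bS x u c (m + 3) < |sdd x (fun j => ρ j ω) (m + 3)|
                ∧ ∀ j, 3 ≤ j → j < m + 3 → |sdd x (fun j => ρ j ω) j| ≤ bS x u c j} := by
        intro ω hω
        simp only [Set.mem_setOf_eq, Set.mem_union] at hω ⊢
        by_cases hF : FailS x u c (fun j => ρ j ω) (m + 2)
        · exact Or.inl hF
        · right
          obtain ⟨k, hk3, hk, hlt⟩ := hω
          have hkm : k = m + 3 := by
            by_contra hne
            exact hF ⟨k, hk3, by omega, hlt⟩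
          subst hkm
          exact ⟨hlt, fun j hj hjm => not_lt.mp (fun h' => hF ⟨j, hj, by omega, h'⟩)⟩
      calc μ {ω | FailS x u c (fun j => ρ j ω) (m + 1 + 2)}
          ≤ μ {ω | FailS x u c (fun j => ρ j ω) (m + 2)}
            + μ {ω | bS x u c (m + 3) < |sdd x (fun j => ρ j ω) (m + 3)|
                ∧ ∀ j, 3 ≤ j → j < m + 3 → |sdd x (fun j => ρ j ω) j| ≤ bS x u c j} :=
            (measure_mono hsub).trans (measure_union_le _ _)
        _ ≤ (m : ℝ≥0∞) * ENNReal.ofReal p + ENNReal.ofReal p :=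
            add_le_add ih (measure_sddFail_le x h hp hc m)
        _ = ((m + 1 : ℕ) : ℝ≥0∞) * ENNReal.ofReal p := by push_cast; ring

/-- LEMMA 22 for the controlling event: `μ {some |s̈_k| > S_k, 3 ≤ k ≤ n} ≤ η` when the bounds
are built with `λ_{n,η} = √(2 ln(2n/η))` (`c = λ_{n,η} u`, i.e. `p = η/n` per step).
[cite: HallmanIpsen2023, §4.3, Lemma 22, proof] -/
theorem measure_failS_le_eta (h : SRErrorModel μ u ρ) (x : ℕ → ℝ) {η : ℝ} (hη : 0 < η) (n : ℕ) :
    μ {ω | FailS x u (STree.lam n η * u) (fun j => ρ j ω) n} ≤ ENNReal.ofReal η := by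
  rcases (show n ≤ 2 ∨ 3 ≤ n by omega) with hn | hn
  · have hempty : {ω | FailS x u (STree.lam n η * u) (fun j => ρ j ω) n} = ∅ := by
      ext ω
      simp only [Set.mem_setOf_eq, Set.mem_empty_iff_false, iff_false, FailS, not_exists, not_and]
      intro k hk hk2; omega
    rw [hempty, measure_empty]; exact bot_le
  · obtain ⟨m, rfl⟩ : ∃ m, n = m + 2 := ⟨n - 2, by omega⟩
    have hnpos : (0 : ℝ) < (m + 2 : ℕ) := by positivity
    have hp : 0 < η / (m + 2 : ℕ) := div_pos hη hnpos
    have hc : STree.lam (m + 2) η * u = Real.sqrt (2 * Real.log (2 / (η / (m + 2 : ℕ)))) * u := by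
      rw [STree.lam, div_div_eq_mul_div]
    calc μ {ω | FailS x u (STree.lam (m + 2) η * u) (fun j => ρ j ω) (m + 2)}
        ≤ (m : ℝ≥0∞) * ENNReal.ofReal (η / (m + 2 : ℕ)) := measure_failS_le x h hp hc m
      _ ≤ ((m + 2 : ℕ) : ℝ≥0∞) * ENNReal.ofReal (η / (m + 2 : ℕ)) := by
          gcongr; exact_mod_cast Nat.le_add_right m 2
      _ = ENNReal.ofReal η := by
          rw [← ENNReal.ofReal_natCast, ← ENNReal.ofReal_mul (Nat.cast_nonneg _)]
          congr 1
          field_simp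

/-- **LEMMA 22 (Hallman–Ipsen): probabilistic bounds for the child-errors of compensated
summation.** Under the model (model:second) for the roundoffs `σ_2, δ_2, β_2, η_3, σ_3, δ_3, …, η_n`
(read off one model sequence `ρ`, see the file header) and `0 < η`, with `λ_{n,η} = √(2 ln(2n/η))`
and the bounds `Y_k, S_k, Z_k, C_k` of (eqn:bbase)/(eqn:bsrec): with probability at least `1 − η`
the bounds `|ÿ_k| ≤ Y_k`, `|s̈_k| ≤ S_k`, `|z̈_k| ≤ Z_k`, `|c̈_k| ≤ C_k` hold simultaneously for all
`2 ≤ k ≤ n`; i.e. `μ {some bound fails} ≤ η`.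
[cite: HallmanIpsen2023, §4.3, Lemma 22 (lemma:sddot, Lem. 22 of the arXiv text),
eqs. (eqn:comp_errorBounds), (eqn:bbase), (eqn:bsrec)] -/
theorem measure_fail_le_eta (h : SRErrorModel μ u ρ) (x : ℕ → ℝ) {η : ℝ} (hη : 0 < η) (n : ℕ) :
    μ {ω | Fail x u (STree.lam n η * u) (fun j => ρ j ω) n} ≤ ENNReal.ofReal η := by
  have hu : 0 ≤ u := u_nonneg h
  have hmono : {ω | Fail x u (STree.lam n η * u) (fun j => ρ j ω) n}
      ⊆ {ω | FailS x u (STree.lam n η * u) (fun j => ρ j ω) n} := fun ω hω =>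
    failS_of_fail x hu (fun i => h.bounded i ω) hω
  exact (measure_mono hmono).trans (measure_failS_le_eta h x hη n)

end Lemma22

/-! ### THEOREM 23: the error in terms of the child-error bounds -/

/-- The coefficient process of `e_n = ṡ_n = (s_n + s̈_n) σ_n + s̈_n`: that of `s̈_n` plus the
coefficient `s_n + s̈_n` at the index `4n+1` of `σ_n`.
[cite: HallmanIpsen2023, §4.3, Theorem 23, proof ("substitute (eqn:srec) into (eqn:comp_sdot)")] -/
noncomputable def coefE (x : ℕ → ℝ) (n : ℕ) (v : ℕ → ℝ) (i : ℕ) : ℝ :=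
  coefC x v i + if i = 4 * n + 1 then psum x n + sdd x v n else 0

/-- The candidate increment bounds of the `e_n`-martingale: those of `s̈_n` plus `|s_n| + S_n` at
the index of `σ_n`. [cite: HallmanIpsen2023, §4.3, Theorem 23, proof ("bound the magnitude of the
summands with probability at least `1 − η` via Lemma 22")] -/
noncomputable def bndE (x : ℕ → ℝ) (u c : ℝ) (n i : ℕ) : ℝ :=
  bndC x u c i + if i = 4 * n + 1 then |psum x n| + bS x u c n else 0

section Theorem23

variable (x : ℕ → ℝ) {u c : ℝ}

/-- **(eqn:comp_sdot) with (eqn:srec) substituted, in martingale-transform form**: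
`e_n = Σ_{i < 4n+2} coefE_i v_i` (`n ≥ 2`). [cite: HallmanIpsen2023, §4.3, Theorem 23, proof] -/
theorem err_eq_transform (v : ℕ → ℝ) {n : ℕ} (hn : 2 ≤ n) :
    err x v n = ∑ i ∈ range (4 * n + 2), coefE x n v i * v i := by
  obtain ⟨m, rfl⟩ : ∃ m, n = m + 2 := ⟨n - 2, by omega⟩
  rw [sum_range_succ, err_rec]
  have hfirst : ∑ i ∈ range (4 * (m + 2) + 1), coefE x (m + 2) v i * v i = sdd x v (m + 2) := by
    rw [sdd_eq_transform x v hn]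
    refine sum_congr rfl (fun i hi => ?_)
    have hne : i ≠ 4 * (m + 2) + 1 := by
      have := mem_range.mp hi; omega
    simp [coefE, hne]
  rw [hfirst]
  simp only [coefE, if_true, coefC_sigma, zero_add, sigmaOf]
  ring

/-- The variance proxy of the `e_n`-martingale: `Σ_{i < 4n+2} bndE_i² = (|s_n| + S_n)² + R_n`
(`n ≥ 2`) — the radicand of Theorem 23. [cite: HallmanIpsen2023, §4.3, Theorem 23] -/
theorem sum_sq_bndE (u c : ℝ) {n : ℕ} (hn : 2 ≤ n) :
    ∑ i ∈ range (4 * n + 2), bndE x u c n i ^ 2 = (|psum x n| + bS x u c n) ^ 2 + bR x u c n := by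
  rw [sum_range_succ, ← sum_sq_bndC x u c hn]
  have hfirst : ∑ i ∈ range (4 * n + 1), bndE x u c n i ^ 2
      = ∑ i ∈ range (4 * n + 1), bndC x u c i ^ 2 := by
    refine sum_congr rfl (fun i hi => ?_)
    have hne : i ≠ 4 * n + 1 := by
      have := mem_range.mp hi; omega
    simp [bndE, hne]
  rw [hfirst]
  simp only [bndE, if_true, bndC_sigma, zero_add]
  ring

/-- `coefE_i` depends only on the roundoffs of index `< i`.
[cite: HallmanIpsen2023, §4.3, Theorem 23, proof (a martingale, as in Theorem 12)] -/
theorem coefE_congr {v w : ℕ → ℝ} (n i : ℕ) (h : ∀ j < i, v j = w j) :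
    coefE x n v i = coefE x n w i := by
  unfold coefE
  rw [coefC_congr x i h]
  by_cases hi : i = 4 * n + 1
  · rw [if_pos hi, if_pos hi, sdd_congr x n (fun j hj => h j (by omega))]
  · rw [if_neg hi, if_neg hi]

/-- `coefE_i` is a measurable function of the roundoff sequence.
[cite: HallmanIpsen2023, §1.2, eq. (model:second)] -/
theorem measurable_coefE (n i : ℕ) : Measurable (fun v : ℕ → ℝ => coefE x n v i) := by
  unfold coefE
  by_cases hi : i = 4 * n + 1
  · simp only [if_pos hi]
    exact (measurable_coefC x i).add (measurable_const.add (measurable_sdd x n))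
  · simp only [if_neg hi, add_zero]; exact measurable_coefC x i

/-- Off the failure event of Lemma 22 every increment bound of the `e_n`-martingale holds
(`n ≥ 2`). [cite: HallmanIpsen2023, §4.3, Theorem 23, proof] -/
theorem abs_coefE_le_bndE (hu : 0 ≤ u) {v : ℕ → ℝ} (hv : ∀ i, |v i| ≤ u) {n : ℕ} (hn : 2 ≤ n)
    (hF : ¬ FailS x u c v n) : ∀ i < 4 * n + 2, |coefE x n v i| ≤ bndE x u c n i := by
  intro i hi
  have hS := abs_sdd_le_of_not_failS x hF
  unfold coefE bndE
  by_cases h1 : i = 4 * n + 1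
  · rw [if_pos h1, if_pos h1, h1, coefC_sigma, bndC_sigma, zero_add, zero_add]
    exact (abs_add_le _ _).trans (add_le_add le_rfl (hS n hn le_rfl))
  · rw [if_neg h1, if_neg h1, add_zero, add_zero]
    exact abs_coefC_le_bndC x hu hv (m := n) (fun j hj hjn => hS j (by omega) hjn) i (by omega)

variable {Ω : Type*} [MeasurableSpace Ω] {μ : Measure Ω} {ρ : ℕ → Ω → ℝ}

omit [MeasurableSpace Ω] in
/-- The coefficient process of `e_n` is predictable. [cite: HallmanIpsen2023, §4.3, Theorem 23,
proof] -/
theorem isPredictable_coefE (n : ℕ) :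
    IsPredictable ρ (fun i ω => coefE x n (fun j => ρ j ω) i) := fun i =>
  ⟨fun v => coefE x n v i, measurable_coefE x n i,
    fun _ _ hvw => coefE_congr x n i (fun j hj => hvw j (Set.mem_Iio.mpr hj)), fun _ => rfl⟩

variable [IsProbabilityMeasure μ]

/-- **Theorem 23 for an arbitrary bound parameter `c ≥ 0`** (the relaxed Azuma–Hoeffding step):
`μ {u √(2 ln(2/p)) ((|s_n|+S_n)² + R_n)^{1/2} < |e_n|} ≤ μ {some |s̈_k| > S_k} + p`.
[cite: HallmanIpsen2023, §4.3, Theorem 23, proof ("apply Lemma 3 with additional probability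
`δ`")] -/
theorem errBound_childBounds_of_failS (h : SRErrorModel μ u ρ) (x : ℕ → ℝ) (hc : 0 ≤ c) {p : ℝ}
    (hp : 0 < p) (n : ℕ) :
    μ {ω | u * Real.sqrt (2 * Real.log (2 / p))
          * Real.sqrt ((|psum x n| + bS x u c n) ^ 2 + bR x u c n) < |err x (fun j => ρ j ω) n|}
      ≤ μ {ω | FailS x u c (fun j => ρ j ω) n} + ENNReal.ofReal p := by
  have hu : 0 ≤ u := u_nonneg h
  rcases (show n ≤ 1 ∨ 2 ≤ n by omega) with hn | hn
  · -- no roundoff has been committed: `e_n = 0`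
    have hempty : {ω | u * Real.sqrt (2 * Real.log (2 / p))
          * Real.sqrt ((|psum x n| + bS x u c n) ^ 2 + bR x u c n) < |err x (fun j => ρ j ω) n|}
        = ∅ := by
      ext ω
      simp only [Set.mem_setOf_eq, Set.mem_empty_iff_false, iff_false, not_lt]
      have he : err x (fun j => ρ j ω) n = 0 := by
        interval_cases n <;> simp
      rw [he, abs_zero]
      positivity
    rw [hempty, measure_empty]; exact bot_le
  set a : ℕ → Ω → ℝ := fun i ω => coefE x n (fun j => ρ j ω) i with ha
  set A : ℕ → ℝ := fun i => bndE x u c n i with hA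
  set N : ℕ := 4 * n + 2 with hN
  have hP : IsPredictable ρ a := isPredictable_coefE x n
  have hA0 : ∀ i, 0 ≤ A i := by
    intro i
    simp only [hA, bndE]
    have h1 := bndC_nonneg x hu hc i
    have h2 := (b_nonneg x hu hc n).2.2.1
    split_ifs <;> positivity
  have hvar : ∑ i ∈ range N, (A i * u) ^ 2
      = u ^ 2 * ((|psum x n| + bS x u c n) ^ 2 + bR x u c n) := by
    rw [← sum_sq_bndE x u c hn, mul_sum]
    exact sum_congr rfl (fun i _ => by ring)
  have hrad : azumaRadius (∑ i ∈ range N, (A i * u) ^ 2) p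
      = u * Real.sqrt (2 * Real.log (2 / p))
          * Real.sqrt ((|psum x n| + bS x u c n) ^ 2 + bR x u c n) := by
    rw [hvar, azumaRadius, sqrt_sq_mul' hu]; ring
  have hsub : {ω | u * Real.sqrt (2 * Real.log (2 / p))
          * Real.sqrt ((|psum x n| + bS x u c n) ^ 2 + bR x u c n) < |err x (fun j => ρ j ω) n|}
      ⊆ {ω | FailS x u c (fun j => ρ j ω) n}
        ∪ {ω | azumaRadius (∑ i ∈ range N, (A i * u) ^ 2) p < |truncTransform a A ρ N ω|} := by
    intro ω hω
    simp only [Set.mem_setOf_eq, Set.mem_union] at hω ⊢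
    by_cases hF : FailS x u c (fun j => ρ j ω) n
    · exact Or.inl hF
    · right
      have hbd : ∀ i < N, |a i ω| ≤ A i :=
        abs_coefE_le_bndE x hu (fun i => h.bounded i ω) hn hF
      rw [hrad, truncTransform_eq_transform hbd, transform, ← err_eq_transform x _ hn]
      exact hω
  calc μ {ω | u * Real.sqrt (2 * Real.log (2 / p))
          * Real.sqrt ((|psum x n| + bS x u c n) ^ 2 + bR x u c n) < |err x (fun j => ρ j ω) n|}
      ≤ μ {ω | FailS x u c (fun j => ρ j ω) n}
        + μ {ω | azumaRadius (∑ i ∈ range N, (A i * u) ^ 2) p < |truncTransform a A ρ N ω|} :=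
        (measure_mono hsub).trans (measure_union_le _ _)
    _ ≤ μ {ω | FailS x u c (fun j => ρ j ω) n} + ENNReal.ofReal p := by
        gcongr
        exact azumaHoeffding_trunc h hP hA0 N hp

/-- **THEOREM 23 (Hallman–Ipsen): probabilistic error bound for compensated summation in terms of
the child-error bounds.** Under the model (model:second) for `σ_2, δ_2, β_2, η_3, …, η_n, σ_n`, with
`0 < η`, `0 < p` (HI's `δ`), `λ_{n,η} = √(2 ln(2n/η))` and the bounds `Y_j, S_j, Z_j, C_j` of
Lemma 22: with probability at least `1 − (p + η)`,
`|e_n| ≤ u√(2ln(2/p)) ((|s_n|+S_n)² + Σ_{j=3}^n ((|x_j|+Y_j)² + C_{j−1}² + (|x_{j−1}|+Z_{j−1})²))^½`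
(the sum is `bR`, see `bR_eq_sum`; the print has `(s_n+S_n)²`, see the typing notes).
[cite: HallmanIpsen2023, §4.3, Theorem 23 (lemma:compProbErr, Thm. 23 of the arXiv text)] -/
theorem errBound_childBounds (h : SRErrorModel μ u ρ) (x : ℕ → ℝ) {η p : ℝ} (hη : 0 < η)
    (hp : 0 < p) (n : ℕ) :
    μ {ω | u * Real.sqrt (2 * Real.log (2 / p))
          * Real.sqrt ((|psum x n| + bS x u (STree.lam n η * u) n) ^ 2
              + bR x u (STree.lam n η * u) n) < |err x (fun j => ρ j ω) n|}
      ≤ ENNReal.ofReal (p + η) := by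
  have hu : 0 ≤ u := u_nonneg h
  have hc : 0 ≤ STree.lam n η * u := mul_nonneg (STree.lam_nonneg _ _) hu
  calc _ ≤ μ {ω | FailS x u (STree.lam n η * u) (fun j => ρ j ω) n} + ENNReal.ofReal p :=
        errBound_childBounds_of_failS h x hc hp n
    _ ≤ ENNReal.ofReal η + ENNReal.ofReal p := by
        gcongr; exact measure_failS_le_eta h x hη n
    _ = ENNReal.ofReal (p + η) := by rw [ENNReal.ofReal_add hp.le hη.le, add_comm]

end Theorem23

/-! ### LEMMA 24: the two-norm constant `α` of the bound recursion -/

/-- The constant `α ≡ √(1 + 3(1+u)² + 2(1+u)⁴) / (1 − u(1+u)²) = √6 + O(u)` of Lemma 24 /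
Theorem 25 (meaningful for `u(1+u)² < 1`).
[cite: HallmanIpsen2023, §4.3, Theorem 25 (definition of `α`); §7 (appendix), last display] -/
noncomputable def alpha (u : ℝ) : ℝ :=
  Real.sqrt (1 + 3 * (1 + u) ^ 2 + 2 * (1 + u) ^ 4) / (1 - u * (1 + u) ^ 2)

/-- The driving term `ω_k ≡ |s_k| + |x_k| + S_k` of the linear recurrence behind (eqn:bsrec):
`Z_k = u ω_k + (1+u)² C_{k−1}`, `C_k = u(1+u) ω_k + u(1+u)² C_{k−1}`.
[cite: HallmanIpsen2023, §7 (appendix, proof of Lemma 24), first display] -/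
noncomputable def omg (x : ℕ → ℝ) (u c : ℝ) (k : ℕ) : ℝ := |psum x k| + |x k| + bS x u c k

section Folklore

/-- [folklore] Minkowski's inequality (the 2-norm triangle inequality) for finite sums, from the
Cauchy–Schwarz inequality. -/
private theorem mink_sum {ι : Type*} (s : Finset ι) (f g : ι → ℝ) :
    Real.sqrt (∑ i ∈ s, (f i + g i) ^ 2)
      ≤ Real.sqrt (∑ i ∈ s, f i ^ 2) + Real.sqrt (∑ i ∈ s, g i ^ 2) := by
  have hf0 : 0 ≤ ∑ i ∈ s, f i ^ 2 := sum_nonneg (fun _ _ => sq_nonneg _)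
  have hg0 : 0 ≤ ∑ i ∈ s, g i ^ 2 := sum_nonneg (fun _ _ => sq_nonneg _)
  have hcs : ∑ i ∈ s, f i * g i ≤ Real.sqrt (∑ i ∈ s, f i ^ 2) * Real.sqrt (∑ i ∈ s, g i ^ 2) :=
    Real.sum_mul_le_sqrt_mul_sqrt s f g
  have hexp : ∑ i ∈ s, (f i + g i) ^ 2
      = ∑ i ∈ s, f i ^ 2 + 2 * ∑ i ∈ s, f i * g i + ∑ i ∈ s, g i ^ 2 := by
    rw [mul_sum, ← sum_add_distrib, ← sum_add_distrib]
    exact sum_congr rfl (fun i _ => by ring)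
  rw [Real.sqrt_le_left (by positivity), hexp, add_sq, Real.sq_sqrt hf0, Real.sq_sqrt hg0]
  nlinarith [hcs]

/-- [folklore] Minkowski's inequality is additive over a concatenation of blocks
(Cauchy–Schwarz in the plane). -/
private theorem mink_add {P₁ P₂ S₁ S₂ Q₁ Q₂ : ℝ} (hP₁ : 0 ≤ P₁) (hP₂ : 0 ≤ P₂) (hS₁ : 0 ≤ S₁)
    (hS₂ : 0 ≤ S₂) (hQ₁ : 0 ≤ Q₁) (hQ₂ : 0 ≤ Q₂)
    (h₁ : Real.sqrt P₁ ≤ Real.sqrt S₁ + Real.sqrt Q₁)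
    (h₂ : Real.sqrt P₂ ≤ Real.sqrt S₂ + Real.sqrt Q₂) :
    Real.sqrt (P₁ + P₂) ≤ Real.sqrt (S₁ + S₂) + Real.sqrt (Q₁ + Q₂) := by
  set a := Real.sqrt S₁ with ha
  set b := Real.sqrt S₂ with hb
  set x := Real.sqrt Q₁ with hx
  set y := Real.sqrt Q₂ with hy
  have ha0 : 0 ≤ a := Real.sqrt_nonneg _
  have hb0 : 0 ≤ b := Real.sqrt_nonneg _
  have hx0 : 0 ≤ x := Real.sqrt_nonneg _
  have hy0 : 0 ≤ y := Real.sqrt_nonneg _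
  have ha2 : a ^ 2 = S₁ := Real.sq_sqrt hS₁
  have hb2 : b ^ 2 = S₂ := Real.sq_sqrt hS₂
  have hx2 : x ^ 2 = Q₁ := Real.sq_sqrt hQ₁
  have hy2 : y ^ 2 = Q₂ := Real.sq_sqrt hQ₂
  have e₁ : P₁ ≤ (a + x) ^ 2 := by
    have := Real.sq_sqrt hP₁
    nlinarith [Real.sqrt_nonneg P₁]
  have e₂ : P₂ ≤ (b + y) ^ 2 := by
    have := Real.sq_sqrt hP₂
    nlinarith [Real.sqrt_nonneg P₂]
  have cs : a * x + b * y ≤ Real.sqrt (S₁ + S₂) * Real.sqrt (Q₁ + Q₂) := by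
    rw [← Real.sqrt_mul (add_nonneg hS₁ hS₂)]
    refine (le_abs_self _).trans (Real.abs_le_sqrt ?_)
    rw [← ha2, ← hb2, ← hx2, ← hy2]
    nlinarith [sq_nonneg (a * y - b * x)]
  have hXY : 0 ≤ Real.sqrt (S₁ + S₂) + Real.sqrt (Q₁ + Q₂) := by positivity
  rw [Real.sqrt_le_left hXY]
  have hX2 : Real.sqrt (S₁ + S₂) ^ 2 = S₁ + S₂ := Real.sq_sqrt (add_nonneg hS₁ hS₂)
  have hY2 : Real.sqrt (Q₁ + Q₂) ^ 2 = Q₁ + Q₂ := Real.sq_sqrt (add_nonneg hQ₁ hQ₂)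
  nlinarith [e₁, e₂, cs, hX2, hY2, ha2, hb2, hx2, hy2]

/-- [folklore] Minkowski's inequality for a finite family of vectors. -/
private theorem mink_family {α β : Type*} [DecidableEq β] (s : Finset α) (t : Finset β)
    (w : β → α → ℝ) :
    Real.sqrt (∑ a ∈ s, (∑ b ∈ t, w b a) ^ 2) ≤ ∑ b ∈ t, Real.sqrt (∑ a ∈ s, w b a ^ 2) := by
  refine Finset.induction_on t (by simp) ?_
  intro b t hb ih
  rw [sum_insert hb]
  have hins : ∀ a, ∑ b' ∈ insert b t, w b' a = w b a + ∑ b' ∈ t, w b' a :=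
    fun a => sum_insert hb
  simp only [hins]
  exact (mink_sum s _ _).trans (add_le_add le_rfl ih)

/-- [folklore] index shift `j ↦ j − 1` on an interval. -/
private theorem sum_Ico_succ_shift (f : ℕ → ℝ) (a n : ℕ) :
    ∑ j ∈ Ico (a + 1) (n + 1), f (j - 1) = ∑ j ∈ Ico a n, f j := by
  rw [sum_Ico_eq_sum_range, sum_Ico_eq_sum_range, Nat.add_sub_add_right]
  exact sum_congr rfl (fun t _ => by congr 1; omega)

/-- [folklore] `Σ_{j=2}^{m} f(j−1) = f(1) + Σ_{j=2}^{m−1} f(j)`. -/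
private theorem sum_Ico_two_pred (f : ℕ → ℝ) : ∀ m, 2 ≤ m →
    ∑ j ∈ Ico 2 (m + 1), f (j - 1) = f 1 + ∑ j ∈ Ico 2 m, f j
  | 0, h | 1, h => by omega
  | 2, _ => by
      rw [sum_Ico_succ_top (le_refl 2), Ico_self, sum_empty]
      norm_num
  | m + 3, _ => by
      rw [sum_Ico_succ_top (by omega : 2 ≤ m + 3), sum_Ico_two_pred f (m + 2) (by omega),
        sum_Ico_succ_top (by omega : 2 ≤ m + 2)]
      simp only [show m + 3 - 1 = m + 2 from rfl]
      ring

/-- [folklore] the one-step "Jensen" inequality `(A + bC)² ≤ A²/(1−b) + bC²` (`0 ≤ b < 1`):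
`(1−b)(A²/(1−b) + bC² − (A+bC)²) = b(A − (1−b)C)²`. -/
private theorem jensen_step {A C b : ℝ} (hb0 : 0 ≤ b) (hb1 : b < 1) :
    (A + b * C) ^ 2 ≤ A ^ 2 / (1 - b) + b * C ^ 2 := by
  have h1b : 0 < 1 - b := by linarith
  rw [div_add' _ _ _ h1b.ne', le_div_iff₀ h1b]
  nlinarith [mul_nonneg hb0 (sq_nonneg (A - (1 - b) * C))]

/-- [folklore] the hockey-stick identity over `range`, cast to `ℝ`:
`Σ_{N<K} C(N,m) = C(K,m+1)`. -/
private theorem hockey_range (K m : ℕ) :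
    ∑ N ∈ range K, ((N.choose m : ℕ) : ℝ) = ((K.choose (m + 1) : ℕ) : ℝ) := by
  induction K with
  | zero => simp
  | succ K ih => rw [sum_range_succ, ih, Nat.choose_succ_succ', Nat.cast_add, add_comm]

end Folklore

section Lemma24

variable (x : ℕ → ℝ) {u c : ℝ}

/-- `α ≥ 0` when `u(1+u)² < 1`. [cite: HallmanIpsen2023, §4.3, Theorem 25 (definition of `α`)] -/
theorem alpha_nonneg (hb : u * (1 + u) ^ 2 < 1) : 0 ≤ alpha u :=
  div_nonneg (Real.sqrt_nonneg _) (by linarith)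

/-- `ω_k ≥ 0`. [cite: HallmanIpsen2023, §7 (appendix), first display] -/
theorem omg_nonneg (hu : 0 ≤ u) (hc : 0 ≤ c) (k : ℕ) : 0 ≤ omg x u c k := by
  have := (b_nonneg x hu hc k).2.2.1
  unfold omg; positivity

/-- (eqn:apx_zrec) `Z_k = u ω_k + (1+u)Y_k = u ω_k + (1+u)² C_{k−1}` (`k ≥ 3`), and `Z_2 ≤ u ω_2`
(`C_1 = 0`). [cite: HallmanIpsen2023, §7 (appendix, proof of Lemma 24), eq. (eqn:apx_zrec) and the
line after it] -/
theorem bZ_le_omg (hu : 0 ≤ u) {j : ℕ} (hj : 2 ≤ j) :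
    bZ x u c j ≤ u * omg x u c j + (1 + u) ^ 2 * bC x u c (j - 1) := by
  obtain ⟨t, rfl⟩ : ∃ t, j = t + 2 := ⟨j - 2, by omega⟩
  cases t with
  | zero =>
      obtain ⟨-, -, hS, hZ, -⟩ := b_two x u c
      have h1 : bC x u c 1 = 0 := (b_le_one x u c le_rfl).2.2.2.2
      simp only [zero_add, show 2 - 1 = 1 from rfl]
      rw [hZ, h1, omg, hS]
      nlinarith [abs_nonneg (x 2), abs_nonneg (psum x 2)]
  | succ t =>
      have h : bZ x u c (t + 3) = u * omg x u c (t + 3) + (1 + u) ^ 2 * bC x u c (t + 2) := by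
        rw [bZ_succ, bY_succ, omg]; ring
      simp only [show t + 1 + 2 = t + 3 from rfl, show t + 3 - 1 = t + 2 from rfl]
      exact h.le

/-- (eqn:apx_crec) `C_k = u ω_k + u Z_k = u(1+u) ω_k + u(1+u)² C_{k−1}` (`k ≥ 3`), and
`C_2 ≤ u(1+u) ω_2`. [cite: HallmanIpsen2023, §7 (appendix, proof of Lemma 24), eq. (eqn:apx_crec)
and the line after it] -/
theorem bC_le_omg (hu : 0 ≤ u) {j : ℕ} (hj : 2 ≤ j) :
    bC x u c j ≤ u * (1 + u) * omg x u c j + u * (1 + u) ^ 2 * bC x u c (j - 1) := by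
  obtain ⟨t, rfl⟩ : ∃ t, j = t + 2 := ⟨j - 2, by omega⟩
  cases t with
  | zero =>
      obtain ⟨-, -, hS, hZ, hC⟩ := b_two x u c
      have h1 : bC x u c 1 = 0 := (b_le_one x u c le_rfl).2.2.2.2
      simp only [zero_add, show 2 - 1 = 1 from rfl]
      rw [hC, hZ, h1, omg, hS]
      nlinarith [abs_nonneg (x 2), abs_nonneg (psum x 2),
        mul_nonneg (mul_nonneg hu hu) (abs_nonneg (x 2))]
  | succ t =>
      have h : bC x u c (t + 3) = u * (1 + u) * omg x u c (t + 3)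
          + u * (1 + u) ^ 2 * bC x u c (t + 2) := by
        rw [bC_succ, bZ_succ, bY_succ, omg]; ring
      simp only [show t + 1 + 2 = t + 3 from rfl, show t + 3 - 1 = t + 2 from rfl]
      exact h.le

/-- [folklore] the shifted sum `Σ_{j=2}^{m−1} C_{j−1}²` is dominated by `Σ_{j=2}^{m−1} C_j²`
(`C_1 = 0`). -/
private theorem sum_sq_bC_pred_le (u c : ℝ) (m : ℕ) :
    ∑ j ∈ Ico 2 m, bC x u c (j - 1) ^ 2 ≤ ∑ j ∈ Ico 2 m, bC x u c j ^ 2 := by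
  rcases (show m ≤ 2 ∨ 3 ≤ m by omega) with hm | hm
  · rw [Finset.Ico_eq_empty_of_le hm]; simp
  · obtain ⟨n, rfl⟩ : ∃ n, m = n + 1 := ⟨m - 1, by omega⟩
    rw [sum_Ico_two_pred (fun j => bC x u c j ^ 2) n (by omega), (b_le_one x u c le_rfl).2.2.2.2,
      sum_Ico_succ_top (by omega : 2 ≤ n)]
    nlinarith [sq_nonneg (bC x u c n)]

/-- **`‖c_k‖₂ ≤ u(1+u)/(1−β) ‖w_k‖₂`** (squared): `Σ_{j=2}^{m−1} C_j² ≤ (u(1+u)/(1−u(1+u)²))²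
Σ_{j=2}^{m−1} ω_j²` — the componentwise inequality `c_k ≤ u(1+u) w_k + β U c_k` solved with the unit
upper triangular `I − βU` (here: summing the one-step bound
`C_j² ≤ (u(1+u)ω_j)²/(1−β) + β C_{j−1}²`).
[cite: HallmanIpsen2023, §7 (appendix, proof of Lemma 24), the bound for `‖c_k‖₂`] -/
theorem sum_sq_bC_le (hu : 0 ≤ u) (hc : 0 ≤ c) (hb : u * (1 + u) ^ 2 < 1) (m : ℕ) :
    ∑ j ∈ Ico 2 m, bC x u c j ^ 2
      ≤ (u * (1 + u) / (1 - u * (1 + u) ^ 2)) ^ 2 * ∑ j ∈ Ico 2 m, omg x u c j ^ 2 := by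
  have hD : 0 < 1 - u * (1 + u) ^ 2 := by linarith
  have hDne : 1 - u * (1 + u) ^ 2 ≠ 0 := hD.ne'
  have hβ0 : 0 ≤ u * (1 + u) ^ 2 := by positivity
  set P := ∑ j ∈ Ico 2 m, bC x u c j ^ 2 with hP
  set W := ∑ j ∈ Ico 2 m, omg x u c j ^ 2 with hW
  have hW0 : 0 ≤ W := sum_nonneg (fun _ _ => sq_nonneg _)
  have hstep : ∀ j ∈ Ico 2 m, bC x u c j ^ 2
      ≤ (u * (1 + u) * omg x u c j) ^ 2 / (1 - u * (1 + u) ^ 2)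
        + u * (1 + u) ^ 2 * bC x u c (j - 1) ^ 2 := by
    intro j hj
    have hj2 : 2 ≤ j := (mem_Ico.mp hj).1
    have hCj : 0 ≤ bC x u c j := (b_nonneg x hu hc j).2.2.2.2
    calc bC x u c j ^ 2
        ≤ (u * (1 + u) * omg x u c j + u * (1 + u) ^ 2 * bC x u c (j - 1)) ^ 2 :=
          pow_le_pow_left₀ hCj (bC_le_omg x hu hj2) 2
      _ ≤ _ := jensen_step hβ0 hb
  have hsum : P ≤ (u * (1 + u)) ^ 2 / (1 - u * (1 + u) ^ 2) * W + u * (1 + u) ^ 2 * P := by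
    calc P ≤ ∑ j ∈ Ico 2 m, ((u * (1 + u) * omg x u c j) ^ 2 / (1 - u * (1 + u) ^ 2)
          + u * (1 + u) ^ 2 * bC x u c (j - 1) ^ 2) := sum_le_sum hstep
      _ = (u * (1 + u)) ^ 2 / (1 - u * (1 + u) ^ 2) * W
          + u * (1 + u) ^ 2 * ∑ j ∈ Ico 2 m, bC x u c (j - 1) ^ 2 := by
          rw [sum_add_distrib, hW, mul_sum, mul_sum]
          congr 1
          exact sum_congr rfl (fun j _ => by ring)
      _ ≤ (u * (1 + u)) ^ 2 / (1 - u * (1 + u) ^ 2) * W + u * (1 + u) ^ 2 * P := by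
          gcongr; exact sum_sq_bC_pred_le x u c m
  have h1 : P * (1 - u * (1 + u) ^ 2) ≤ (u * (1 + u)) ^ 2 / (1 - u * (1 + u) ^ 2) * W := by
    nlinarith [hsum]
  rw [div_pow, div_mul_eq_mul_div, le_div_iff₀ (pow_pos hD 2)]
  calc P * (1 - u * (1 + u) ^ 2) ^ 2
      = P * (1 - u * (1 + u) ^ 2) * (1 - u * (1 + u) ^ 2) := by ring
    _ ≤ (u * (1 + u)) ^ 2 / (1 - u * (1 + u) ^ 2) * W * (1 - u * (1 + u) ^ 2) :=
        mul_le_mul_of_nonneg_right h1 hD.le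
    _ = (u * (1 + u)) ^ 2 * W := by field_simp

/-- **`‖z_k‖₂ ≤ u‖w_k‖₂ + (1+u)²‖c_k‖₂ ≤ u(2+2u+u²)/(1−β) ‖w_k‖₂`**:
`(Σ_{j=2}^{m−1} Z_j²)^{1/2} ≤ u(2+2u+u²)/(1−u(1+u)²) (Σ_{j=2}^{m−1} ω_j²)^{1/2}`.
[cite: HallmanIpsen2023, §7 (appendix, proof of Lemma 24), the bound for `‖z_k‖₂`] -/
theorem sqrt_sum_sq_bZ_le (hu : 0 ≤ u) (hc : 0 ≤ c) (hb : u * (1 + u) ^ 2 < 1) (m : ℕ) :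
    Real.sqrt (∑ j ∈ Ico 2 m, bZ x u c j ^ 2)
      ≤ u * (2 + 2 * u + u ^ 2) / (1 - u * (1 + u) ^ 2)
        * Real.sqrt (∑ j ∈ Ico 2 m, omg x u c j ^ 2) := by
  have hD : 0 < 1 - u * (1 + u) ^ 2 := by linarith
  have hDne : 1 - u * (1 + u) ^ 2 ≠ 0 := hD.ne'
  set W := ∑ j ∈ Ico 2 m, omg x u c j ^ 2 with hW
  have hW0 : 0 ≤ W := sum_nonneg (fun _ _ => sq_nonneg _)
  have h1 : Real.sqrt (∑ j ∈ Ico 2 m, bZ x u c j ^ 2)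
      ≤ Real.sqrt (∑ j ∈ Ico 2 m, (u * omg x u c j + (1 + u) ^ 2 * bC x u c (j - 1)) ^ 2) :=
    Real.sqrt_le_sqrt (sum_le_sum (fun j hj => pow_le_pow_left₀ (b_nonneg x hu hc j).2.2.2.1
      (bZ_le_omg x hu (mem_Ico.mp hj).1) 2))
  have h2 := mink_sum (Ico 2 m) (fun j => u * omg x u c j) (fun j => (1 + u) ^ 2 * bC x u c (j - 1))
  have h3 : Real.sqrt (∑ j ∈ Ico 2 m, (u * omg x u c j) ^ 2) = u * Real.sqrt W := by
    rw [show ∑ j ∈ Ico 2 m, (u * omg x u c j) ^ 2 = u ^ 2 * W by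
      rw [hW, mul_sum]; exact sum_congr rfl (fun j _ => by ring)]
    exact sqrt_sq_mul' hu
  have h4 : Real.sqrt (∑ j ∈ Ico 2 m, ((1 + u) ^ 2 * bC x u c (j - 1)) ^ 2)
      ≤ (1 + u) ^ 2 * (u * (1 + u) / (1 - u * (1 + u) ^ 2) * Real.sqrt W) := by
    rw [show ∑ j ∈ Ico 2 m, ((1 + u) ^ 2 * bC x u c (j - 1)) ^ 2
        = ((1 + u) ^ 2) ^ 2 * ∑ j ∈ Ico 2 m, bC x u c (j - 1) ^ 2 by
      rw [mul_sum]; exact sum_congr rfl (fun j _ => by ring), sqrt_sq_mul' (by positivity)]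
    refine mul_le_mul_of_nonneg_left ?_ (by positivity)
    calc Real.sqrt (∑ j ∈ Ico 2 m, bC x u c (j - 1) ^ 2)
        ≤ Real.sqrt (∑ j ∈ Ico 2 m, bC x u c j ^ 2) := Real.sqrt_le_sqrt (sum_sq_bC_pred_le x u c m)
      _ ≤ Real.sqrt ((u * (1 + u) / (1 - u * (1 + u) ^ 2)) ^ 2 * W) :=
          Real.sqrt_le_sqrt (sum_sq_bC_le x hu hc hb m)
      _ = u * (1 + u) / (1 - u * (1 + u) ^ 2) * Real.sqrt W :=
          sqrt_sq_mul' (div_nonneg (by positivity) hD.le)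
  calc Real.sqrt (∑ j ∈ Ico 2 m, bZ x u c j ^ 2)
      ≤ u * Real.sqrt W + (1 + u) ^ 2 * (u * (1 + u) / (1 - u * (1 + u) ^ 2) * Real.sqrt W) :=
        h1.trans (h2.trans (by rw [h3]; exact add_le_add le_rfl h4))
    _ = u * (2 + 2 * u + u ^ 2) / (1 - u * (1 + u) ^ 2) * Real.sqrt W := by
        field_simp
        ring

/-- **LEMMA 24 (Hallman–Ipsen; `lemma:alphaBound`, proved in the appendix §7).** With
`α = √(1+3(1+u)²+2(1+u)⁴)/(1−u(1+u)²)` (`= √6 + O(u)`; hypothesis `u(1+u)² < 1`) the terms of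
Lemma 22 satisfy, for `3 ≤ k`,
`(Σ_{j=3}^{k} (Y_j² + C_{j−1}² + Z_{j−1}²))^{1/2} ≤ αu (Σ_{j=2}^{k−1} (|s_j| + |x_j| + S_j)²)^{1/2}`
(the Frobenius norm of `[(1+u)c_k, c_k, z_k]`).
[cite: HallmanIpsen2023, §4.3, Lemma 24 (lemma:alphaBound, Lem. 24 of the arXiv text); §7
(appendix), proof] -/
theorem frobenius_le_alpha (hu : 0 ≤ u) (hc : 0 ≤ c) (hb : u * (1 + u) ^ 2 < 1) {k : ℕ}
    (hk : 3 ≤ k) :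
    Real.sqrt (∑ j ∈ Ico 3 (k + 1), (bY x u c j ^ 2 + bC x u c (j - 1) ^ 2 + bZ x u c (j - 1) ^ 2))
      ≤ alpha u * u * Real.sqrt (∑ j ∈ Ico 2 k, (|psum x j| + |x j| + bS x u c j) ^ 2) := by
  have hD : 0 < 1 - u * (1 + u) ^ 2 := by linarith
  have hDne : 1 - u * (1 + u) ^ 2 ≠ 0 := hD.ne'
  have _hk := hk
  set W := ∑ j ∈ Ico 2 k, omg x u c j ^ 2 with hW
  have hWeq : ∑ j ∈ Ico 2 k, (|psum x j| + |x j| + bS x u c j) ^ 2 = W := rfl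
  have hW0 : 0 ≤ W := sum_nonneg (fun _ _ => sq_nonneg _)
  have hshift : ∑ j ∈ Ico 3 (k + 1), (bY x u c j ^ 2 + bC x u c (j - 1) ^ 2 + bZ x u c (j - 1) ^ 2)
      = ∑ i ∈ Ico 2 k, (((1 + u) ^ 2 + 1) * bC x u c i ^ 2 + bZ x u c i ^ 2) := by
    rw [← sum_Ico_succ_shift (fun i => ((1 + u) ^ 2 + 1) * bC x u c i ^ 2 + bZ x u c i ^ 2) 2 k]
    refine sum_congr rfl (fun j hj => ?_)
    obtain ⟨t, rfl⟩ : ∃ t, j = t + 3 := ⟨j - 3, by have := (mem_Ico.mp hj).1; omega⟩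
    simp only [show t + 3 - 1 = t + 2 from rfl, bY_succ]
    ring
  rw [hshift, sum_add_distrib, ← mul_sum, hWeq]
  have hP : ∑ i ∈ Ico 2 k, bC x u c i ^ 2 ≤ (u * (1 + u) / (1 - u * (1 + u) ^ 2)) ^ 2 * W :=
    sum_sq_bC_le x hu hc hb k
  have hQ : ∑ i ∈ Ico 2 k, bZ x u c i ^ 2
      ≤ (u * (2 + 2 * u + u ^ 2) / (1 - u * (1 + u) ^ 2)) ^ 2 * W := by
    have h := sqrt_sum_sq_bZ_le x hu hc hb k
    have h0 : 0 ≤ ∑ i ∈ Ico 2 k, bZ x u c i ^ 2 := sum_nonneg (fun _ _ => sq_nonneg _)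
    calc ∑ i ∈ Ico 2 k, bZ x u c i ^ 2 = Real.sqrt (∑ i ∈ Ico 2 k, bZ x u c i ^ 2) ^ 2 :=
          (Real.sq_sqrt h0).symm
      _ ≤ (u * (2 + 2 * u + u ^ 2) / (1 - u * (1 + u) ^ 2) * Real.sqrt W) ^ 2 :=
          pow_le_pow_left₀ (Real.sqrt_nonneg _) h 2
      _ = (u * (2 + 2 * u + u ^ 2) / (1 - u * (1 + u) ^ 2)) ^ 2 * W := by
          rw [mul_pow, Real.sq_sqrt hW0]
  have hα : (alpha u * u) ^ 2 = ((1 + u) ^ 2 + 1) * (u * (1 + u) / (1 - u * (1 + u) ^ 2)) ^ 2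
      + (u * (2 + 2 * u + u ^ 2) / (1 - u * (1 + u) ^ 2)) ^ 2 := by
    unfold alpha
    rw [mul_pow, div_pow, Real.sq_sqrt (by positivity)]
    field_simp
    ring
  have hP' := mul_le_mul_of_nonneg_left hP (by positivity : (0:ℝ) ≤ (1 + u) ^ 2 + 1)
  have htot : ((1 + u) ^ 2 + 1) * ∑ i ∈ Ico 2 k, bC x u c i ^ 2 + ∑ i ∈ Ico 2 k, bZ x u c i ^ 2
      ≤ (alpha u * u) ^ 2 * W := by
    rw [hα]; linarith [hP', hQ]
  have hαu : 0 ≤ alpha u * u := mul_nonneg (alpha_nonneg hb) hu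
  calc Real.sqrt (((1 + u) ^ 2 + 1) * ∑ i ∈ Ico 2 k, bC x u c i ^ 2 + ∑ i ∈ Ico 2 k, bZ x u c i ^ 2)
      ≤ Real.sqrt ((alpha u * u) ^ 2 * W) := Real.sqrt_le_sqrt htot
    _ = alpha u * u * Real.sqrt W := sqrt_sq_mul' hαu

end Lemma24

/-! ### THEOREM 25: the error in terms of partial sums and inputs -/

/-- The constant `γ ≡ √(1 + λ_{n,η}² u²) (1 + λ_{n,η} α √(2n) u² exp(λ_{n,η}² α² n u⁴)) = 1 + O(u²)`
of Theorem 25, as a function of `n`, `u` and `λ = λ_{n,η}`.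
[cite: HallmanIpsen2023, §4.3, Theorem 25 (definition of `γ`)] -/
noncomputable def gamma (n : ℕ) (u lam' : ℝ) : ℝ :=
  Real.sqrt (1 + lam' ^ 2 * u ^ 2)
    * (1 + lam' * alpha u * Real.sqrt (2 * n) * u ^ 2
        * Real.exp (lam' ^ 2 * alpha u ^ 2 * n * u ^ 4))

/-- The binomial sum `B(N) = Σ_{j=0}^{N} q^j √(C(N,j))` of the closed-form step ("Proceed as in the
proof of Theorem 15"), `q = λ_{n,η} α u²`.
[cite: HallmanIpsen2023, §4.3, Theorem 25, proof (the display with `Σ_{j=0}^n (λ_{n,η} α u²)^j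
√(n choose j)`); §2.2, Theorem 15, proof] -/
noncomputable def binB (q : ℝ) (N : ℕ) : ℝ := ∑ m ∈ range (N + 1), q ^ m * Real.sqrt (N.choose m)

section Theorem25

variable (x : ℕ → ℝ) {u c : ℝ}

/-- `γ ≥ 0`. [cite: HallmanIpsen2023, §4.3, Theorem 25 (definition of `γ`)] -/
theorem gamma_nonneg (hb : u * (1 + u) ^ 2 < 1) {lam' : ℝ} (hl : 0 ≤ lam') (n : ℕ) :
    0 ≤ gamma n u lam' := by
  have := alpha_nonneg hb
  unfold gamma; positivity

/-- `B(N) ≥ 0`. [cite: HallmanIpsen2023, §4.3, Theorem 25, proof] -/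
theorem binB_nonneg {q : ℝ} (hq : 0 ≤ q) (N : ℕ) : 0 ≤ binB q N :=
  sum_nonneg (fun m _ => by positivity)

/-- **The binomial recursion** behind "Proceed as in the proof of Theorem 15": for `q ≥ 0`,
`1 + q (Σ_{N<K} B(N)²)^{1/2} ≤ B(K)` (Minkowski over the family `m ↦ (q^m √C(N,m))_N` and the
hockey-stick identity `Σ_{N<K} C(N,m) = C(K,m+1)`).
[cite: HallmanIpsen2023, §4.3, Theorem 25, proof ("Proceed as in the proof of Theorem
(thm:model2Analysis)"); §2.2, Theorem 15, proof] -/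
theorem binB_step {q : ℝ} (hq : 0 ≤ q) (K : ℕ) :
    1 + q * Real.sqrt (∑ N ∈ range K, binB q N ^ 2) ≤ binB q K := by
  have hext : ∀ N ∈ range K, binB q N = ∑ m ∈ range K, q ^ m * Real.sqrt (N.choose m) := by
    intro N hN
    have hNK := mem_range.mp hN
    unfold binB
    have hsub : range (N + 1) ⊆ range K :=
      fun m hm => mem_range.mpr (by have := mem_range.mp hm; omega)
    refine sum_subset hsub (fun m hm hm' => ?_)
    have hlt : N < m := by
      have h1 : m < K := mem_range.mp hm
      have h2 : ¬ m < N + 1 := fun h' => hm' (mem_range.mpr h')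
      omega
    rw [Nat.choose_eq_zero_of_lt hlt]
    simp
  have h1 : ∑ N ∈ range K, binB q N ^ 2
      = ∑ N ∈ range K, (∑ m ∈ range K, q ^ m * Real.sqrt (N.choose m)) ^ 2 :=
    sum_congr rfl (fun N hN => by rw [hext N hN])
  have h2 := mink_family (range K) (range K) (fun m N => q ^ m * Real.sqrt (N.choose m))
  have h3 : ∀ m, Real.sqrt (∑ N ∈ range K, (q ^ m * Real.sqrt (N.choose m)) ^ 2)
      = q ^ m * Real.sqrt (K.choose (m + 1)) := by
    intro m
    rw [show ∑ N ∈ range K, (q ^ m * Real.sqrt (N.choose m)) ^ 2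
        = (q ^ m) ^ 2 * ∑ N ∈ range K, ((N.choose m : ℕ) : ℝ) by
      rw [mul_sum]
      exact sum_congr rfl (fun N _ => by rw [mul_pow, Real.sq_sqrt (Nat.cast_nonneg _)]),
      sqrt_sq_mul' (pow_nonneg hq m), hockey_range]
  calc 1 + q * Real.sqrt (∑ N ∈ range K, binB q N ^ 2)
      ≤ 1 + q * ∑ m ∈ range K, q ^ m * Real.sqrt (K.choose (m + 1)) := by
        rw [h1]
        gcongr
        exact h2.trans_eq (sum_congr rfl (fun m _ => h3 m))
    _ = binB q K := by
        unfold binB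
        rw [sum_range_succ', mul_sum]
        simp only [pow_zero, Nat.choose_zero_right, Nat.cast_one, Real.sqrt_one, mul_one]
        rw [add_comm]
        congr 1
        exact sum_congr rfl (fun m _ => by ring)

/-- **The recursive two-norm step** (first four displayed lines of the proof of Theorem 25): with
`R_j² = (|x_j|+Y_j)² + C_{j−1}² + (|x_{j−1}|+Z_{j−1})²` and
`T_k = (Σ_{j=3}^k R_j²)^{1/2} = √(bR k)`,
`T_k ≤ (√2 + αu)(Σ_{i=2}^k x_i²)^{1/2} + αu(Σ_{i=2}^k s_i²)^{1/2} + λαu²(Σ_{j=3}^{k−1} T_j²)^{1/2}`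
(`c = λu`), by the three-block Minkowski inequality, Lemma 24, two triangle inequalities and
`S_j = c T_j`. [cite: HallmanIpsen2023, §4.3, Theorem 25, proof (first align display)] -/
theorem sqrt_bR_le_step (hu : 0 ≤ u) (hc : 0 ≤ c) (hb : u * (1 + u) ^ 2 < 1) {k : ℕ}
    (hk : 3 ≤ k) :
    Real.sqrt (bR x u c k)
      ≤ (Real.sqrt 2 + alpha u * u) * Real.sqrt (∑ i ∈ Ico 2 (k + 1), x i ^ 2)
        + alpha u * u * Real.sqrt (∑ i ∈ Ico 2 (k + 1), psum x i ^ 2)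
        + c * (alpha u * u) * Real.sqrt (∑ j ∈ Ico 3 k, bR x u c j) := by
  obtain ⟨m, rfl⟩ : ∃ m, k = m + 2 := ⟨k - 2, by omega⟩
  have hαu : 0 ≤ alpha u * u := mul_nonneg (alpha_nonneg hb) hu
  have hb0 := fun j => b_nonneg x hu hc j
  set Xs := ∑ i ∈ Ico 2 (m + 2 + 1), x i ^ 2 with hXs
  set Ss := ∑ i ∈ Ico 2 (m + 2 + 1), psum x i ^ 2 with hSs
  set Rs := ∑ j ∈ Ico 3 (m + 2), bR x u c j with hRs
  have hXs0 : 0 ≤ Xs := sum_nonneg (fun _ _ => sq_nonneg _)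
  have hSs0 : 0 ≤ Ss := sum_nonneg (fun _ _ => sq_nonneg _)
  have hRs0 : 0 ≤ Rs := sum_nonneg (fun j _ => (hb0 j).1)
  -- (1) the three-block Minkowski inequality
  have n0 : ∀ f : ℕ → ℝ, 0 ≤ ∑ j ∈ Ico 3 (m + 3), f j ^ 2 :=
    fun f => sum_nonneg (fun _ _ => sq_nonneg _)
  have hA := mink_sum (Ico 3 (m + 3)) (fun j => |x j|) (fun j => bY x u c j)
  have hB : Real.sqrt (∑ j ∈ Ico 3 (m + 3), bC x u c (j - 1) ^ 2)
      ≤ Real.sqrt 0 + Real.sqrt (∑ j ∈ Ico 3 (m + 3), bC x u c (j - 1) ^ 2) := by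
    rw [Real.sqrt_zero, zero_add]
  have hC := mink_sum (Ico 3 (m + 3)) (fun j => |x (j - 1)|) (fun j => bZ x u c (j - 1))
  have hAB := mink_add (n0 _) (n0 _) (n0 _) le_rfl (n0 _) (n0 _) hA hB
  have hABC := mink_add (add_nonneg (n0 _) (n0 _)) (n0 _) (add_nonneg (n0 _) le_rfl) (n0 _)
    (add_nonneg (n0 _) (n0 _)) (n0 _) hAB hC
  have h1 : Real.sqrt (bR x u c (m + 2))
      ≤ Real.sqrt (∑ j ∈ Ico 3 (m + 3), |x j| ^ 2 + 0 + ∑ j ∈ Ico 3 (m + 3), |x (j - 1)| ^ 2)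
        + Real.sqrt (∑ j ∈ Ico 3 (m + 3), bY x u c j ^ 2
            + ∑ j ∈ Ico 3 (m + 3), bC x u c (j - 1) ^ 2
            + ∑ j ∈ Ico 3 (m + 3), bZ x u c (j - 1) ^ 2) := by
    rw [bR_eq_sum]
    simp only [sum_add_distrib]
    exact hABC
  -- (2) the `x`-blocks: `‖x‖² + ‖x'‖² ≤ 2 Σ_{i=2}^{k} x_i²`
  have h2 : Real.sqrt (∑ j ∈ Ico 3 (m + 3), |x j| ^ 2 + 0 + ∑ j ∈ Ico 3 (m + 3), |x (j - 1)| ^ 2)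
      ≤ Real.sqrt 2 * Real.sqrt Xs := by
    rw [← Real.sqrt_mul zero_le_two]
    refine Real.sqrt_le_sqrt ?_
    have hXabs : Xs = ∑ i ∈ Ico 2 (m + 2 + 1), |x i| ^ 2 := by
      rw [hXs]; exact sum_congr rfl (fun i _ => (sq_abs (x i)).symm)
    have e1 : ∑ j ∈ Ico 3 (m + 3), |x j| ^ 2 ≤ Xs := by
      have hsub : Ico 3 (m + 3) ⊆ Ico 2 (m + 2 + 1) := Ico_subset_Ico (by norm_num) (by omega)
      rw [hXabs]
      exact sum_le_sum_of_subset_of_nonneg hsub (fun _ _ _ => sq_nonneg _)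
    have e2 : ∑ j ∈ Ico 3 (m + 3), |x (j - 1)| ^ 2 ≤ Xs := by
      have hs : ∑ j ∈ Ico 3 (m + 3), |x (j - 1)| ^ 2 = ∑ i ∈ Ico 2 (m + 2), |x i| ^ 2 :=
        sum_Ico_succ_shift (fun i => |x i| ^ 2) 2 (m + 2)
      have hsub : Ico 2 (m + 2) ⊆ Ico 2 (m + 2 + 1) := Ico_subset_Ico le_rfl (by omega)
      rw [hs, hXabs]
      exact sum_le_sum_of_subset_of_nonneg hsub (fun _ _ _ => sq_nonneg _)
    linarith
  -- (3) Lemma 24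
  have h3 : Real.sqrt (∑ j ∈ Ico 3 (m + 3), (bY x u c j ^ 2 + bC x u c (j - 1) ^ 2
        + bZ x u c (j - 1) ^ 2))
      ≤ alpha u * u * Real.sqrt (∑ j ∈ Ico 2 (m + 2), (|psum x j| + |x j| + bS x u c j) ^ 2) :=
    frobenius_le_alpha x hu hc hb (by omega : 3 ≤ m + 2)
  have h3' : Real.sqrt (∑ j ∈ Ico 3 (m + 3), bY x u c j ^ 2
        + ∑ j ∈ Ico 3 (m + 3), bC x u c (j - 1) ^ 2 + ∑ j ∈ Ico 3 (m + 3), bZ x u c (j - 1) ^ 2)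
      ≤ alpha u * u * Real.sqrt (∑ j ∈ Ico 2 (m + 2), (|psum x j| + |x j| + bS x u c j) ^ 2) := by
    simpa only [sum_add_distrib] using h3
  -- (4) two triangle inequalities and `S_j = c T_j`
  have h4 : Real.sqrt (∑ j ∈ Ico 2 (m + 2), (|psum x j| + |x j| + bS x u c j) ^ 2)
      ≤ Real.sqrt Ss + Real.sqrt Xs + c * Real.sqrt Rs := by
    have hA' := mink_sum (Ico 2 (m + 2)) (fun j => |psum x j| + |x j|) (fun j => bS x u c j)
    have hB' := mink_sum (Ico 2 (m + 2)) (fun j => |psum x j|) (fun j => |x j|)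
    have hsub : Ico 2 (m + 2) ⊆ Ico 2 (m + 2 + 1) := Ico_subset_Ico le_rfl (by omega)
    have e1 : Real.sqrt (∑ j ∈ Ico 2 (m + 2), |psum x j| ^ 2) ≤ Real.sqrt Ss := by
      refine Real.sqrt_le_sqrt ?_
      rw [hSs, ← sum_congr rfl (fun i (_ : i ∈ Ico 2 (m + 2 + 1)) => sq_abs (psum x i))]
      exact sum_le_sum_of_subset_of_nonneg hsub (fun _ _ _ => sq_nonneg _)
    have e2 : Real.sqrt (∑ j ∈ Ico 2 (m + 2), |x j| ^ 2) ≤ Real.sqrt Xs := by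
      refine Real.sqrt_le_sqrt ?_
      rw [hXs, ← sum_congr rfl (fun i (_ : i ∈ Ico 2 (m + 2 + 1)) => sq_abs (x i))]
      exact sum_le_sum_of_subset_of_nonneg hsub (fun _ _ _ => sq_nonneg _)
    have e3 : Real.sqrt (∑ j ∈ Ico 2 (m + 2), bS x u c j ^ 2) = c * Real.sqrt Rs := by
      have hsum : ∑ j ∈ Ico 2 (m + 2), bS x u c j ^ 2 = c ^ 2 * Rs := by
        rw [sum_eq_sum_Ico_succ_bot (by omega : 2 < m + 2), (b_two x u c).2.2.1, hRs, mul_sum,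
          zero_pow two_ne_zero, zero_add]
        refine sum_congr rfl (fun j _ => ?_)
        rw [bS, mul_pow, Real.sq_sqrt (hb0 j).1]
      rw [hsum, sqrt_sq_mul' hc]
    calc Real.sqrt (∑ j ∈ Ico 2 (m + 2), (|psum x j| + |x j| + bS x u c j) ^ 2)
        ≤ Real.sqrt (∑ j ∈ Ico 2 (m + 2), (|psum x j| + |x j|) ^ 2)
          + Real.sqrt (∑ j ∈ Ico 2 (m + 2), bS x u c j ^ 2) := hA'
      _ ≤ Real.sqrt (∑ j ∈ Ico 2 (m + 2), |psum x j| ^ 2)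
          + Real.sqrt (∑ j ∈ Ico 2 (m + 2), |x j| ^ 2)
          + Real.sqrt (∑ j ∈ Ico 2 (m + 2), bS x u c j ^ 2) := add_le_add hB' le_rfl
      _ ≤ Real.sqrt Ss + Real.sqrt Xs + c * Real.sqrt Rs := by
          rw [e3]; exact add_le_add (add_le_add e1 e2) le_rfl
  -- (5) assemble
  calc Real.sqrt (bR x u c (m + 2)) ≤ _ := h1
    _ ≤ Real.sqrt 2 * Real.sqrt Xs
        + alpha u * u * (Real.sqrt Ss + Real.sqrt Xs + c * Real.sqrt Rs) :=
        add_le_add h2 (h3'.trans (mul_le_mul_of_nonneg_left h4 hαu))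
    _ = (Real.sqrt 2 + alpha u * u) * Real.sqrt Xs + alpha u * u * Real.sqrt Ss
        + c * (alpha u * u) * Real.sqrt Rs := by ring

/-- **The closed-form recursion solved** ("Proceed as in the proof of Theorem 15"): for
`3 ≤ k ≤ n`, `T_k ≤ a_n B(k−3)` with
`a_n = (√2+αu)(Σ_{i=2}^n x_i²)^{1/2} + αu(Σ_{i=2}^n s_i²)^{1/2}`, `B(N) = Σ_{j=0}^N q^j √C(N,j)`,
`q = cαu = λαu²`.
[cite: HallmanIpsen2023, §4.3, Theorem 25, proof, eq. (eqn:c_Rbound) (the display after "Proceed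
as in the proof of Theorem (thm:model2Analysis)")] -/
theorem sqrt_bR_le_binB (hu : 0 ≤ u) (hc : 0 ≤ c) (hb : u * (1 + u) ^ 2 < 1) (n : ℕ) :
    ∀ k, 3 ≤ k → k ≤ n → Real.sqrt (bR x u c k)
      ≤ ((Real.sqrt 2 + alpha u * u) * Real.sqrt (∑ i ∈ Ico 2 (n + 1), x i ^ 2)
          + alpha u * u * Real.sqrt (∑ i ∈ Ico 2 (n + 1), psum x i ^ 2))
        * binB (c * (alpha u * u)) (k - 3) := by
  have hαu : 0 ≤ alpha u * u := mul_nonneg (alpha_nonneg hb) hu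
  have hq0 : 0 ≤ c * (alpha u * u) := mul_nonneg hc hαu
  set a := (Real.sqrt 2 + alpha u * u) * Real.sqrt (∑ i ∈ Ico 2 (n + 1), x i ^ 2)
    + alpha u * u * Real.sqrt (∑ i ∈ Ico 2 (n + 1), psum x i ^ 2) with ha
  have ha0 : 0 ≤ a := by positivity
  -- strong induction on `k`
  suffices H : ∀ N k, k < N → 3 ≤ k → k ≤ n →
      Real.sqrt (bR x u c k) ≤ a * binB (c * (alpha u * u)) (k - 3) from
    fun k => H (k + 1) k (Nat.lt_succ_self k)
  intro N
  induction N with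
  | zero => intro k hk; omega
  | succ N ih =>
      intro k hkN hk3 hkn
      have hstep := sqrt_bR_le_step x hu hc hb hk3
      have hXk : Real.sqrt (∑ i ∈ Ico 2 (k + 1), x i ^ 2)
          ≤ Real.sqrt (∑ i ∈ Ico 2 (n + 1), x i ^ 2) :=
        Real.sqrt_le_sqrt (sum_le_sum_of_subset_of_nonneg (Ico_subset_Ico le_rfl (by omega))
          (fun _ _ _ => sq_nonneg _))
      have hSk : Real.sqrt (∑ i ∈ Ico 2 (k + 1), psum x i ^ 2)
          ≤ Real.sqrt (∑ i ∈ Ico 2 (n + 1), psum x i ^ 2) :=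
        Real.sqrt_le_sqrt (sum_le_sum_of_subset_of_nonneg (Ico_subset_Ico le_rfl (by omega))
          (fun _ _ _ => sq_nonneg _))
      have hak : (Real.sqrt 2 + alpha u * u) * Real.sqrt (∑ i ∈ Ico 2 (k + 1), x i ^ 2)
          + alpha u * u * Real.sqrt (∑ i ∈ Ico 2 (k + 1), psum x i ^ 2) ≤ a :=
        add_le_add (mul_le_mul_of_nonneg_left hXk (add_nonneg (Real.sqrt_nonneg 2) hαu))
          (mul_le_mul_of_nonneg_left hSk hαu)
      have hrec : ∑ j ∈ Ico 3 k, bR x u c j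
          ≤ a ^ 2 * ∑ M ∈ range (k - 3), binB (c * (alpha u * u)) M ^ 2 := by
        rw [mul_sum, sum_Ico_eq_sum_range]
        refine sum_le_sum (fun t ht => ?_)
        have htk : 3 + t < k := by have := mem_range.mp ht; omega
        have hj := ih (3 + t) (by omega) (by omega) (by omega)
        rw [show 3 + t - 3 = t by omega] at hj
        have h0 : 0 ≤ bR x u c (3 + t) := (b_nonneg x hu hc _).1
        calc bR x u c (3 + t) = Real.sqrt (bR x u c (3 + t)) ^ 2 := (Real.sq_sqrt h0).symm
          _ ≤ (a * binB (c * (alpha u * u)) t) ^ 2 := pow_le_pow_left₀ (Real.sqrt_nonneg _) hj 2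
          _ = a ^ 2 * binB (c * (alpha u * u)) t ^ 2 := by ring
      have hsq : Real.sqrt (∑ j ∈ Ico 3 k, bR x u c j)
          ≤ a * Real.sqrt (∑ M ∈ range (k - 3), binB (c * (alpha u * u)) M ^ 2) :=
        (Real.sqrt_le_sqrt hrec).trans_eq (sqrt_sq_mul' ha0)
      calc Real.sqrt (bR x u c k)
          ≤ a + c * (alpha u * u)
              * (a * Real.sqrt (∑ M ∈ range (k - 3), binB (c * (alpha u * u)) M ^ 2)) :=
            hstep.trans (add_le_add hak (mul_le_mul_of_nonneg_left hsq hq0))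
        _ = a * (1 + c * (alpha u * u)
              * Real.sqrt (∑ M ∈ range (k - 3), binB (c * (alpha u * u)) M ^ 2)) := by ring
        _ ≤ a * binB (c * (alpha u * u)) (k - 3) :=
            mul_le_mul_of_nonneg_left (binB_step hq0 (k - 3)) ha0

/-- **The deterministic content of THEOREM 25 (first line).** With `c = λu` (`λ ≥ 0`),
`u(1+u)² < 1`, and `γ`, `α` as defined: for every `n`,
`((|s_n|+S_n)² + Σ_{j=3}^n R_j²)^½ ≤ |s_n| + γ(√2+αu)(Σ_{k=2}^n x_k²)^½ + γαu(Σ_{k=2}^n s_k²)^½`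
— the inequality `(a+b)²+c² ≤ (a+√(b²+c²))²`, `S_n² + T_n² = (1+λ²u²)T_n²`, the recursion
(eqn:c_Rbound) and (eqn:c_binBound) `Σ_{j=1}^n q^j √C(n,j) ≤ q √(2n) exp(q² n)` (`q = λαu²`; used
at `n − 3 ≤ n`). [cite: HallmanIpsen2023, §4.3, Theorem 25, proof, eqs. (eqn:c_Rbound),
(eqn:c_binBound) and the last display ("Combine this with (eqn:c_Rbound) and (eqn:c_binBound)")] -/
theorem closedForm_le (hu : 0 ≤ u) {lam' : ℝ} (hl : 0 ≤ lam') (hb : u * (1 + u) ^ 2 < 1) (n : ℕ) :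
    Real.sqrt ((|psum x n| + bS x u (lam' * u) n) ^ 2 + bR x u (lam' * u) n)
      ≤ |psum x n|
        + gamma n u lam' * (Real.sqrt 2 + alpha u * u) * Real.sqrt (∑ k ∈ Ico 2 (n + 1), x k ^ 2)
        + gamma n u lam' * (alpha u * u) * Real.sqrt (∑ k ∈ Ico 2 (n + 1), psum x k ^ 2) := by
  have hc : 0 ≤ lam' * u := mul_nonneg hl hu
  have hα : 0 ≤ alpha u := alpha_nonneg hb
  have hαu : 0 ≤ alpha u * u := mul_nonneg hα hu
  have hq0 : 0 ≤ lam' * u * (alpha u * u) := mul_nonneg hc hαu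
  have hS0 : 0 ≤ bS x u (lam' * u) n := (b_nonneg x hu hc n).2.2.1
  have hR0 : 0 ≤ bR x u (lam' * u) n := (b_nonneg x hu hc n).1
  set a := (Real.sqrt 2 + alpha u * u) * Real.sqrt (∑ i ∈ Ico 2 (n + 1), x i ^ 2)
    + alpha u * u * Real.sqrt (∑ i ∈ Ico 2 (n + 1), psum x i ^ 2) with ha
  have ha0 : 0 ≤ a := by positivity
  -- (1) peel off `|s_n|`: `(a+b)² + r ≤ (a + √(b²+r))²`
  have hT : bS x u (lam' * u) n ≤ Real.sqrt (bS x u (lam' * u) n ^ 2 + bR x u (lam' * u) n) := by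
    have := Real.sqrt_le_sqrt (le_add_of_nonneg_right hR0 : bS x u (lam' * u) n ^ 2
      ≤ bS x u (lam' * u) n ^ 2 + bR x u (lam' * u) n)
    rwa [Real.sqrt_sq hS0] at this
  have h1 : Real.sqrt ((|psum x n| + bS x u (lam' * u) n) ^ 2 + bR x u (lam' * u) n)
      ≤ |psum x n| + Real.sqrt (bS x u (lam' * u) n ^ 2 + bR x u (lam' * u) n) := by
    rw [Real.sqrt_le_left (by positivity)]
    have hq := Real.sq_sqrt (add_nonneg (sq_nonneg (bS x u (lam' * u) n)) hR0)
    nlinarith [hq, hT, abs_nonneg (psum x n)]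
  -- (2) `S_n² + T_n² = (1 + c²) T_n²`
  have h2 : Real.sqrt (bS x u (lam' * u) n ^ 2 + bR x u (lam' * u) n)
      = Real.sqrt (1 + (lam' * u) ^ 2) * Real.sqrt (bR x u (lam' * u) n) := by
    rw [← Real.sqrt_mul (by positivity)]
    congr 1
    rw [bS, mul_pow, Real.sq_sqrt hR0]; ring
  -- (3) the solved recursion and Theorem 15's final estimate
  have h3 : Real.sqrt (bR x u (lam' * u) n)
      ≤ a * (1 + lam' * u * (alpha u * u) * Real.sqrt (2 * n)
          * Real.exp ((lam' * u * (alpha u * u)) ^ 2 * n)) := by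
    have hfac : 0 ≤ 1 + lam' * u * (alpha u * u) * Real.sqrt (2 * n)
        * Real.exp ((lam' * u * (alpha u * u)) ^ 2 * n) := by positivity
    rcases (show n ≤ 2 ∨ 3 ≤ n by omega) with hn | hn
    · have hR : bR x u (lam' * u) n = 0 := by
        rcases (show n ≤ 1 ∨ n = 2 by omega) with hn1 | rfl
        · exact (b_le_one x u (lam' * u) hn1).1
        · exact (b_two x u (lam' * u)).1
      rw [hR, Real.sqrt_zero]
      positivity
    · refine (sqrt_bR_le_binB x hu hc hb n n hn le_rfl).trans (mul_le_mul_of_nonneg_left ?_ ha0)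
      calc binB (lam' * u * (alpha u * u)) (n - 3)
          ≤ 1 + lam' * u * (alpha u * u) * Real.sqrt (2 * (n - 3 : ℕ))
              * Real.exp ((lam' * u * (alpha u * u)) ^ 2 * (n - 3 : ℕ)) :=
            STree.binomialSum_le_one_add hq0 (n - 3)
        _ ≤ 1 + lam' * u * (alpha u * u) * Real.sqrt (2 * n)
              * Real.exp ((lam' * u * (alpha u * u)) ^ 2 * n) := by
            gcongr <;> exact_mod_cast Nat.sub_le n 3
  -- (4) `γ` in these terms
  have hγ : gamma n u lam' = Real.sqrt (1 + (lam' * u) ^ 2)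
      * (1 + lam' * u * (alpha u * u) * Real.sqrt (2 * n)
          * Real.exp ((lam' * u * (alpha u * u)) ^ 2 * n)) := by
    unfold gamma
    ring_nf
  calc Real.sqrt ((|psum x n| + bS x u (lam' * u) n) ^ 2 + bR x u (lam' * u) n)
      ≤ |psum x n| + Real.sqrt (bS x u (lam' * u) n ^ 2 + bR x u (lam' * u) n) := h1
    _ = |psum x n| + Real.sqrt (1 + (lam' * u) ^ 2) * Real.sqrt (bR x u (lam' * u) n) := by rw [h2]
    _ ≤ |psum x n| + Real.sqrt (1 + (lam' * u) ^ 2)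
          * (a * (1 + lam' * u * (alpha u * u) * Real.sqrt (2 * n)
              * Real.exp ((lam' * u * (alpha u * u)) ^ 2 * n))) := by
        gcongr
    _ = |psum x n| + gamma n u lam' * (Real.sqrt 2 + alpha u * u)
            * Real.sqrt (∑ k ∈ Ico 2 (n + 1), x k ^ 2)
          + gamma n u lam' * (alpha u * u) * Real.sqrt (∑ k ∈ Ico 2 (n + 1), psum x k ^ 2) := by
        rw [hγ, ha]; ring

variable {Ω : Type*} [MeasurableSpace Ω] {μ : Measure Ω} {ρ : ℕ → Ω → ℝ} [IsProbabilityMeasure μ]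

/-- **THEOREM 25 (Hallman–Ipsen), first line: probabilistic error bound for compensated summation
in terms of partial sums and inputs.** Under the model (model:second) for
`σ_2, δ_2, β_2, η_3, σ_3, δ_3, …, η_n, σ_n` (one model sequence `ρ`, see the file header), with
`0 < η`, `0 < p` (HI's `δ`), `λ_{n,η} = √(2 ln(2n/η))`, and the explicit constants `α` (hypothesis
`u(1+u)² < 1`, under which `α` is the displayed positive real) and `γ`: with probability at least
`1 − (p + η)`,
`|e_n| ≤ u √(2 ln(2/p)) (|s_n| + γ(√2+αu)(Σ_{k=2}^n x_k²)^{1/2} + γαu(Σ_{k=2}^n s_k²)^{1/2})`.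
(The second printed line, `≤ u√(2ln(2/δ))(1+√2+√6(√n+1)u) Σ|x_k| + O(u³)`, is an asymptotic
simplification and is not typed.)
[cite: HallmanIpsen2023, §4.3, Theorem 25 (thm:comp_prob_err, Thm. 25 of the arXiv text), first
displayed inequality, with the definitions of `α` and `γ`] -/
theorem errBound_closedForm (h : SRErrorModel μ u ρ) (x : ℕ → ℝ) {η p : ℝ} (hη : 0 < η)
    (hp : 0 < p) (hb : u * (1 + u) ^ 2 < 1) (n : ℕ) :
    μ {ω | u * Real.sqrt (2 * Real.log (2 / p))
          * (|psum x n|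
            + gamma n u (STree.lam n η) * (Real.sqrt 2 + alpha u * u)
                * Real.sqrt (∑ k ∈ Ico 2 (n + 1), x k ^ 2)
            + gamma n u (STree.lam n η) * (alpha u * u)
                * Real.sqrt (∑ k ∈ Ico 2 (n + 1), psum x k ^ 2))
          < |err x (fun j => ρ j ω) n|}
      ≤ ENNReal.ofReal (p + η) := by
  have hu : 0 ≤ u := u_nonneg h
  refine (measure_mono ?_).trans (errBound_childBounds h x hη hp n)
  intro ω hω
  simp only [Set.mem_setOf_eq] at hω ⊢
  refine lt_of_le_of_lt ?_ hω
  exact mul_le_mul_of_nonneg_left (closedForm_le x hu (STree.lam_nonneg n η) hb n) (by positivity)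

end Theorem25




end Compensated

end Literature.ComputerArithmetic.HallmanIpsen2023
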